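import Literature.Combinatorics.Optimization.PsdRankWorkedExamples
import Literature.Combinatorics.Optimization.BlockPsdLiftFactorization
import Literature.Combinatorics.Optimization.PsdFactorNorms
import Mathlib.NumberTheory.Bertrand
import Literature.Combinatorics.Optimization.LPRelaxationsMaxCSP
import Literature.LinearAlgebra.Matrix.HadamardProductRank
import HarnessLib

/-!
# Lee–Wei: the square root rank of the correlation polytope is exponential — Theorems 8, 9, 12, 13,
# Lemmas 10, 14, Definition 11 and Proposition 15, all PROVED

Source: T. Lee, Z. Wei, *The square root rank of the correlation polytope is exponential*,
arXiv:1411.6712 (2014) [LeeWei2014] (held text `paper:arxiv-1411.6712`; statements quoted from PDF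
pp. 5–6). "The square root rank of a nonnegative matrix `A` is the minimum rank of a matrix `B` such
that `A = B ∘ B`, where `∘` denotes entrywise product" (Def. 2; tree: FGPRT Def. 5.2
`HasHadamardSqrtOfRankLE M r` = "`rank_√(M) ≤ r`", file `PsdRankComparisons.lean`); "the square root
rank is an upper bound on the positive semidefinite rank … and corresponds [to] the special case where
all matrices in the factorization are rank-one" (abstract; tree: FGPRT Prop. 6.2
`FawziEtAl2015_prop62_holds`).

* **Theorem 8** (p. 5): "Let `𝔽` be a subfield of the real numbers and `p` a prime such that `√p ∉ 𝔽`.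
  Then for any univariate polynomial `q(x)` with coefficients in `𝔽` the multiplicity of `√p` and `−√p`
  as roots of `q` is the same." Here `SquareRootRank.rootMultiplicity_eq_and_le`, for an intermediate
  field `K` of `ℝ/ℚ` and any real `a ∉ K` with `a² ∈ K` (the printed proof uses nothing else about
  `√p`): equal multiplicities, and (for monic `q`) twice the multiplicity is at most `deg q` — via the
  printed division-with-remainder argument `SquareRootRank.X_sq_sub_C_dvd_of_root` ("`m = x² − p`
  divides any polynomial that has a root at `√p`").
* **Theorem 9** (p. 5): "Let `𝔽` be a subfield of the real numbers and `p` a prime such that `√p ∉ 𝔽`.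
  Let `A ∈ 𝔽^{N×N}`. Then `rank(√p I + A) ≥ ⌈N/2⌉`." Here `SquareRootRank.card_le_two_mul_rank`
  (`N ≤ 2·rank(aI + A)`) and `SquareRootRank.half_card_le_rank`, by the printed route: the nullity of
  `aI + A` is the geometric multiplicity of the eigenvalue `−a` of `A`, at most its algebraic
  multiplicity in the characteristic polynomial (coefficients in `K`), which by Theorem 8 equals that
  of `+a`, and the two together are at most `N`.
* **Lemma 10** (p. 5): "The `2ⁿ`-by-`2ⁿ` matrix `M_n = [(xᵀy−1)(xᵀy−2)]_{x,y ∈ {0,1}ⁿ}` is a submatrix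
  of the slack matrix of the correlation polytope `COR_n`", with the printed certificate
  "`(xᵀy−1)(xᵀy−2) = Tr((xxᵀ − 3 diag(x)) yyᵀ) + 2 ≥ 0`" (eq. (1)). Here, over the tree's
  `FixedSizePsdRank.corPolytope n = conv{x xᵀ : x ∈ {0,1}ⁿ} ⊂ ℝ^{n²}` (`BlockPsdLiftFactorization.lean`):
  `SquareRootRank.lwM` (the matrix `M_n`), `SquareRootRank.lwCoeff` (the coefficient matrix
  `xxᵀ − 3 diag(x)`), `SquareRootRank.LeeWei2014_lemma10` (the inequality `⟨xxᵀ − 3 diag(x), Y⟩ + 2 ≥ 0`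
  is valid on `COR_n` and its slack at the vertex `yyᵀ` is `M_n(x,y)`).
* **Definition 11** (p. 5): "Fix `n` and let `p` be the prime closest to `n/2` … Define the matrix `P_n`
  to be the submatrix of `M_n` restricted to strings of Hamming weight `p + 1`. Note that the size of
  `P_n` is `C(n, p+1)`." Here `SquareRootRank.lwP n p` on `SquareRootRank.WeightSets n (p+1)` (the
  `(p+1)`-subsets of `[n]`, `P(x,y) = (|x ∩ y| − 1)(|x ∩ y| − 2)`), for EVERY `p` (the choice of `p` only
  enters the count, see below); `lwP_eq_lwM`, `lwP_eq_slack` (it is the said submatrix of `M_n` / of the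
  slack matrix), `card_weightSets` (size `C(n, p+1)`).
* **Theorem 12** (p. 6): "Let `n` be a positive integer and let `N` be the size of `P_n`. Then
  `rank_√(P_n) ≥ ⌈N/2⌉`. In particular, `rank_√(P_n) ≥ 3^{n/3−1}`." Here
  `SquareRootRank.LeeWei2014_thm12`: for a prime `p ≥ 3`, every real `B` with `B ∘ B = P_n` has
  `N ≤ 2·rank B`, by the printed proof — the diagonal of `B` is `±√(p(p−1))`, rescaling the rows by
  `±1/√(p−1)` (a diagonal `D`, `rank DB = rank B`) makes the diagonal `√p` while every off-diagonal
  entry `±√((t−1)(t−2))/√(p−1)`, `t = |x ∩ y| ≤ p`, lies in `𝔽 = ℚ(√q : q prime, q < p)`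
  (`SquareRootRank.primeSqrtField`, the tree's `sqrtField`), and `√p ∉ 𝔽` — "see exercise 6.15 of
  Stewart, *Galois Theory* (3rd ed., 2004)"; in the tree this is the special case `sqrt_not_mem_sqrtField` of Besicovitch's theorem
  [Besicovitch1940] (`PsdRankWorkedExamples.lean`) — so Theorem 9 applies to `DB = √p I + A`. The
  hypothesis `p ≥ 3` is implicit in the text (for `p = 2` the off-diagonal entries `±√2` of `DB` are not
  in `𝔽 = ℚ`; the paper's `p` is the prime closest to `n/2`, `n` large). Packaged forms:
  `half_card_le_of_hasHadamardSqrtOfRankLE` (`rank_√(P_n) ≤ r ⇒ ⌈N/2⌉ ≤ r`) and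
  `half_card_le_of_rankOne_psdFactorization` (every psd factorization of `P_n` with rank-one factors
  has size `≥ ⌈N/2⌉`, through FGPRT Prop. 6.2). The numerical corollary "`rank_√(P_n) ≥ 3^{n/3−1}`"
  (the paper's headline, §1: "a lower bound of `3^{n/3−1}` on the square root rank of the slack matrix
  of `COR_n`"; Def. 11: "By Bertrand's Postulate … the size of `P_n` is at least `C(n, ⌈n/3⌉)`") is
  `LeeWei2014_thm12_exp` / `LeeWei2014_thm12_rpow` / `LeeWei2014_thm12_exp'`: for every `n ≥ 6` there is
  a prime `p ≥ 3`, `p + 1 ≤ n` (a Bertrand prime in `(⌊n/3⌋, 2⌊n/3⌋]`, Mathlib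
  `Nat.exists_prime_lt_and_le_two_mul`) with `3ⁿ ≤ (3·rank B)³`, i.e. `rank B ≥ 3^{n/3−1}`, for every
  Hadamard square root `B` of `P_n`; the count is `C(n,p+1) ≥ C(n,⌊n/3⌋)` resp. `≥ C(n,⌊n/3⌋+1) ≥
  2·C(3⌊n/3⌋,⌊n/3⌋)` (binomials increase towards the middle) and `C(m,k) ≥ 3^k` for `3k ≤ m`
  (Vandermonde). The paper states the corollary for all positive `n` with ITS `p` (closest prime to
  `n/2`); for `n ≤ 3` its `P_n` is the empty matrix, and the typed version lets Bertrand pick the prime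
  — `-- TODO(general form): the corollary for the specific prime closest to n/2`.

* **§5 (Perspective) and Proposition 15** (p. 8): "Define … `F_n(x,y) = xᵀy(xᵀy−1)`. This matrix is
  also a slack matrix of the correlation polytope as can be verified by a very similar proof to
  [Lemma 10]. … the proof [of Theorem 12] can be simply modified to show that `F_n` has exponential
  square root rank … On the other hand … even the nonnegative rank of `F_n` is small. Proposition 15.
  `rank_+(F_n) ≤ C(n,2)`. … this approach is not likely to give exponential lower bounds on the PSD-rank
  of the correlation polytope." Here: `SquareRootRank.lwF` and `LeeWei2014_sec5_slack` (valid inequality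
  `⟨xxᵀ − diag(x), Y⟩ ≥ 0`, slack `F_n(x,y)` at `yyᵀ`); `LeeWei2014_sec5_sqrtRank` (for every prime `p`,
  every Hadamard square root of the weight-`p` block `lwFP n p` of `F_n` has `C(n,p) ≤ 2·rank` — the
  "simple modification" is weight `p` instead of `p + 1`, through the abstracted engine
  `card_le_two_mul_rank_of_prime`); `LeeWei2014_prop15` (`HasNonnegFactorization (lwF n) (C(n,2))`,
  typed by the explicit factorization `F_n(x,y) = Σ_{|S|=2} [S ⊆ x]·2[S ⊆ y]` that the printed recursion
  `F_{n+1} = [[F_n,F_n],[F_n,F_n+D_n]]` unrolls to); `hasPsdFactorization_lwF` (Fact 4: hence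
  `rank_psd(F_n) ≤ C(n,2)`); `LeeWei2014_sec5_separation` (both facts on the same weight-`p` block).

* **§4, Theorem 13 and Lemma 14** (pp. 6–7): "consider a decomposition of the form `P_n = Σ_{j=1}^{d²}
  (B_j ∘ √P_n) ∘ (B_j ∘ √P_n)`, where each matrix `B_j` has rational entries. Let `k` [be] the maximum of
  `rank(B_j ∘ √P_n)` over `j ∈ [d²]`. Then `kd² ≥ ½ C(n, ⌈n/3⌉)`" (Thm. 13), via "Lemma 14. For any
  positive integer `ℓ`, there are matrices with rational entries `σ_1, …, σ_ℓ` each of size `4^{⌈ℓ/2⌉}`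
  such that for any real numbers `a_1, …, a_ℓ`, `(Σ_j a_j σ_j)(Σ_j a_j σ_j) = (Σ_j a_j²) I`" (built from
  "real versions of the Pauli matrices" `X, Y, Z ∈ ℤ^{4×4}` as `σ_{2j} = Z^{⊗j} ⊗ X ⊗ I^{⊗…}`,
  `σ_{2j+1} = Z^{⊗j} ⊗ Y ⊗ I^{⊗…}`). Here: `pX`, `pY`, `pZ`, `pauli_relations` (by `decide`), tensor words
  `tens` on `[4]^m` (`tens_mul`), `sigma m (j, X/Y)` with `sigma_anticomm`, `sigma_mul_self`,
  `card_sigmaIndex` (size `4^m`), the abstract identity `clifford_sq` and `LeeWei2014_lemma14`; and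
  `LeeWei2014_thm13` in the sharper form the printed proof yields — for a prime `p ≥ 3`, rational `B_j`
  (any finite index set `J`) with `P_n(x,y) = Σ_j (B_j(x,y) √P_n(x,y))²`: `N ≤ 2 Σ_j rank(B_j ∘ √P_n)` —
  by the printed route (`C = Σ_j (B_j ∘ √P_n) ⊗ σ_j`, `rank C ≤ 4^m Σ_j rank(B_j ∘ √P_n)` through the
  tree's `rank_kronecker_le_rank_mul_rank`; `D` block diagonal with blocks `(p−1)^{−1/2} Σ_j B_j(i,i) σ_j`;
  `DC = √p I + A` with `A` over `𝔽` since `Σ_j B_j(i,i)² = 1`; Theorem 9), then `LeeWei2014_thm13_max`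
  (`N ≤ 2k|J|`, the printed `kd² ≥ N/2`) and `LeeWei2014_thm13_printed` (`C(n, ⌈n/3⌉) ≤ 2k|J|` for
  `n ≥ 6` and the Bertrand prime, using Def. 11's count `N ≥ C(n, ⌈n/3⌉)`).

* **Two remarks** — §3.1 (p. 5): "`A_n = [xᵀy−1]_{x,y ∈ {0,1}ⁿ}` satisfies `A_n ∘ A_n = B_n` and has
  rank at most `n+1`" (`hasHadamardSqrtOfRankLE_udisj`: `rank_√((xᵀy−1)²) ≤ n + 1`, the matrix being
  the tree's `klwMatrix` written on `bvec`); and the rescaling step of the proof of Theorem 12 in the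
  general form used downstream (`card_le_two_mul_rank_of_rescaling`: diagonal entries `a·w_x`,
  `w_x ∈ K^×`, off-diagonal entries in `K`, `a ∉ K`, `a² ∈ K` ⇒ `N ≤ 2·rank`).

NOT here: §2 Facts 3, 5, 6 and Lemma 7 (basic psd-rank facts; FGPRT material in the tree). No psd-rank
lower bound for `COR_n` is claimed by the source or typed here (the square root rank only
bounds rank-one psd factorizations, and §5 shows the method cannot bound `rank_psd`; `rank_psd` of the
`COR_n` slack matrix is the subject of `CorrelationPolytopePsdRank.lean`). 0 named facts; axioms standard.

presearch: "square root rank correlation polytope" → [galaxy:pdf:6392657116885730360] = the source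
itself (arXiv:1411.6712); corpus hybrid/vsearch: no book treating `rank_√(COR_n)`; tree: FGPRT §5
(`HasHadamardSqrtOfRankLE`, Example 5.18 `le_of_hasHadamardSqrtOfRankLE_primeMatrix`, Remark 6.3
`FawziEtAl2015_rem63_sqrtRank`) and the unique-disjointness matrix `(xᵀy−1)²` (`klwMatrix`,
`GroverSosCertificates.lean`) — no prior typing of [LeeWei2014].
-/

noncomputable section

open Polynomial Matrix Finset

namespace Literature.Combinatorics.Optimization

namespace SquareRootRank

variable (K : IntermediateField ℚ ℝ)

/-! ### §1 Theorem 8: `±√p` have the same multiplicity in polynomials over `F ∌ √p` -/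

/-- If `a ∉ K` but `a² = c ∈ K`, then every `h ∈ K[X]` with a root at `a` or at `−a` (in `ℝ`) is
divisible by `X² − c` (division with remainder: a remainder of degree `≤ 1` vanishing at `±a` is zero).
[cite: LeeWei2014, Thm. 8 (proof)] -/
theorem X_sq_sub_C_dvd_of_root {a : ℝ} (ha : a ∉ K) (c : K) (hc : (c : ℝ) = a ^ 2) (h : K[X])
    (hr : (h.map (algebraMap K ℝ)).eval a = 0 ∨ (h.map (algebraMap K ℝ)).eval (-a) = 0) :
    (X ^ 2 - C c) ∣ h := by
  set m : K[X] := X ^ 2 - C c with hm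
  have hmonic : m.Monic := by
    rw [hm]; exact monic_X_pow_sub_C c two_ne_zero
  have hmdeg : m.degree = 2 := by rw [hm]; exact degree_X_pow_sub_C (by norm_num) c
  rw [← modByMonic_eq_zero_iff_dvd hmonic]
  set r := h %ₘ m with hrdef
  have hrdeg : r.degree ≤ 1 := by
    have := degree_modByMonic_lt h hmonic
    rw [hmdeg] at this
    exact Order.le_of_lt_succ (by exact_mod_cast this)
  have hr_eq := eq_X_add_C_of_degree_le_one hrdeg
  -- evaluate `h = r + m * (h /ₘ m)` at `±a`
  have hma : ∀ b : ℝ, b ^ 2 = a ^ 2 → (m.map (algebraMap K ℝ)).eval b = 0 := by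
    intro b hb
    rw [hm, Polynomial.map_sub, Polynomial.map_pow, map_X, map_C, eval_sub, eval_pow, eval_X, eval_C]
    rw [hb]; show a ^ 2 - (c : ℝ) = 0; rw [hc, sub_self]
  have hdecomp : h = r + m * (h /ₘ m) := (modByMonic_add_div h m).symm
  have hra : ∀ b : ℝ, b ^ 2 = a ^ 2 → (h.map (algebraMap K ℝ)).eval b = 0 →
      ((r.coeff 1 : K) : ℝ) * b + ((r.coeff 0 : K) : ℝ) = 0 := by
    intro b hb hhb
    have := hhb
    rw [hdecomp, Polynomial.map_add, Polynomial.map_mul, eval_add, eval_mul, hma b hb, zero_mul, add_zero,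
      hr_eq, Polynomial.map_add, Polynomial.map_mul, map_C, map_X, map_C, eval_add, eval_mul, eval_C,
      eval_X, eval_C] at this
    exact this
  -- `r.coeff 1 = 0`, for otherwise `±a ∈ K`
  have h1 : r.coeff 1 = 0 := by
    by_contra hne
    have hne' : ((r.coeff 1 : K) : ℝ) ≠ 0 := by exact_mod_cast hne
    rcases hr with h0 | h0
    · have e := hra a rfl h0
      have : a = -((r.coeff 0 : K) : ℝ) / ((r.coeff 1 : K) : ℝ) := by
        field_simp; linarith
      exact ha (this ▸ div_mem (neg_mem (SetLike.coe_mem _)) (SetLike.coe_mem _))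
    · have e := hra (-a) (by ring) h0
      have : a = ((r.coeff 0 : K) : ℝ) / ((r.coeff 1 : K) : ℝ) := by
        field_simp; linarith
      exact ha (this ▸ div_mem (SetLike.coe_mem _) (SetLike.coe_mem _))
  have h0 : r.coeff 0 = 0 := by
    rcases hr with h0 | h0
    · have e := hra a rfl h0
      rw [h1] at e; push_cast at e; simp at e; exact_mod_cast e
    · have e := hra (-a) (by ring) h0
      rw [h1] at e; push_cast at e; simp at e; exact_mod_cast e
  rw [hr_eq, h1, h0, C_0, zero_mul, zero_add]

/-- Factoring out the largest power of a monic polynomial of positive degree. [folklore] -/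
private theorem exists_eq_pow_mul_not_dvd {F : Type*} [Field F] (m : F[X]) (hm : m.Monic)
    (hdeg : 0 < m.natDegree) : ∀ q : F[X], q ≠ 0 → ∃ (e : ℕ) (h : F[X]), q = m ^ e * h ∧ ¬ m ∣ h := by
  intro q
  induction h : q.natDegree using Nat.strong_induction_on generalizing q with
  | _ d ih =>
    intro hq
    by_cases hdvd : m ∣ q
    · obtain ⟨q', rfl⟩ := hdvd
      have hq' : q' ≠ 0 := right_ne_zero_of_mul hq
      have hlt : q'.natDegree < d := by
        rw [← h, natDegree_mul hm.ne_zero hq']; omega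
      obtain ⟨e, h', rfl, hnd⟩ := ih _ hlt q' rfl hq'
      exact ⟨e + 1, h', by ring, hnd⟩
    · exact ⟨0, q, by simp, hdvd⟩

/-- **Lee–Wei Theorem 8 (quantitative form used in Theorem 9).** Let `F ⊆ ℝ` be a subfield, `a ∉ F`
with `a² ∈ F` (e.g. `a = √p`, `p` prime, `√p ∉ F`). For a monic `q ∈ F[X]`, the multiplicities of `a`
and `−a` as real roots of `q` coincide (both equal the multiplicity of the factor `X² − a²`), hence each
is at most `deg q / 2`. [cite: LeeWei2014, Thm. 8] -/
theorem rootMultiplicity_eq_and_le {a : ℝ} (ha : a ∉ K) (c : K) (hc : (c : ℝ) = a ^ 2) (q : K[X])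
    (hq : q.Monic) :
    rootMultiplicity a (q.map (algebraMap K ℝ)) = rootMultiplicity (-a) (q.map (algebraMap K ℝ)) ∧
      2 * rootMultiplicity (-a) (q.map (algebraMap K ℝ)) ≤ q.natDegree := by
  have ha0 : a ≠ 0 := fun h => ha (h ▸ zero_mem K)
  set m : K[X] := X ^ 2 - C c with hm
  have hmonic : m.Monic := by rw [hm]; exact monic_X_pow_sub_C c two_ne_zero
  have hmdeg : m.natDegree = 2 := by rw [hm]; exact natDegree_X_pow_sub_C
  obtain ⟨e, h, hqe, hnd⟩ := exists_eq_pow_mul_not_dvd m hmonic (by omega) q hq.ne_zero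
  set i := algebraMap K ℝ
  have hmmap : m.map i = (X - C a) * (X - C (-a)) := by
    rw [hm, Polynomial.map_sub, Polynomial.map_pow, map_X, map_C]
    show X ^ 2 - C (c : ℝ) = _
    rw [hc, map_neg, sub_neg_eq_add, C_pow]
    ring
  have hh0 : h.map i ≠ 0 := by
    rw [Ne, Polynomial.map_eq_zero]
    rintro rfl
    exact hnd (dvd_zero m)
  have hha : ¬ (h.map i).IsRoot a := fun hr => hnd (X_sq_sub_C_dvd_of_root K ha c hc h (Or.inl hr))
  have hhna : ¬ (h.map i).IsRoot (-a) := fun hr => hnd (X_sq_sub_C_dvd_of_root K ha c hc h (Or.inr hr))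
  have hqmap : q.map i = (X - C a) ^ e * (X - C (-a)) ^ e * h.map i := by
    rw [hqe, Polynomial.map_mul, Polynomial.map_pow, hmmap, mul_pow]
  have hne1 : (X - C a) ^ e * (X - C (-a)) ^ e * h.map i ≠ 0 :=
    mul_ne_zero (mul_ne_zero (pow_ne_zero _ (X_sub_C_ne_zero a)) (pow_ne_zero _ (X_sub_C_ne_zero (-a)))) hh0
  have hne2 : (X - C a) ^ e * (X - C (-a)) ^ e ≠ 0 :=
    mul_ne_zero (pow_ne_zero _ (X_sub_C_ne_zero a)) (pow_ne_zero _ (X_sub_C_ne_zero (-a)))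
  have hr1 : ¬ ((X - C (-a)) ^ e).IsRoot a := by
    intro hr
    rw [IsRoot.def, eval_pow, eval_sub, eval_X, eval_C] at hr
    have hne : e ≠ 0 := by rintro rfl; simp at hr
    have : a - -a = 0 := (pow_eq_zero_iff hne).1 hr
    exact ha0 (by linarith)
  have hr2 : ¬ ((X - C a) ^ e).IsRoot (-a) := by
    intro hr
    rw [IsRoot.def, eval_pow, eval_sub, eval_X, eval_C] at hr
    have hne : e ≠ 0 := by rintro rfl; simp at hr
    have : -a - a = 0 := (pow_eq_zero_iff hne).1 hr
    exact ha0 (by linarith)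
  have hra : rootMultiplicity a (q.map i) = e := by
    rw [hqmap, rootMultiplicity_mul hne1, rootMultiplicity_mul hne2, rootMultiplicity_X_sub_C_pow,
      rootMultiplicity_eq_zero hha, rootMultiplicity_eq_zero hr1, add_zero, add_zero]
  have hrna : rootMultiplicity (-a) (q.map i) = e := by
    rw [hqmap, rootMultiplicity_mul hne1, rootMultiplicity_mul hne2, rootMultiplicity_X_sub_C_pow,
      rootMultiplicity_eq_zero hhna, rootMultiplicity_eq_zero hr2, zero_add, add_zero]
  refine ⟨by rw [hra, hrna], ?_⟩
  rw [hrna]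
  have hdvd : m ^ e ∣ q := ⟨h, hqe⟩
  have := natDegree_le_of_dvd hdvd hq.ne_zero
  rw [natDegree_pow, hmdeg] at this
  omega

/-! ### §2 Theorem 9: `rank(√p·I + A) ≥ ⌈N/2⌉` for `A` with entries in `F` -/

/-- **Lee–Wei Theorem 9.** Let `F ⊆ ℝ` be a subfield and `a ∉ F` with `a² ∈ F` (`a = √p`). For every
square matrix `A` with entries in `F`, `rank(a·I + A) ≥ ⌈N/2⌉` (`N` the size): the nullity is the
geometric multiplicity of the eigenvalue `−a` of `A`, at most its algebraic multiplicity, at most `N/2`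
by Theorem 8 applied to the characteristic polynomial. [cite: LeeWei2014, Thm. 9] -/
theorem card_le_two_mul_rank {ι : Type} [Fintype ι] [DecidableEq ι] {a : ℝ} (ha : a ∉ K) (ha2 : a ^ 2 ∈ K)
    (A : Matrix ι ι ℝ) (hA : ∀ i j, A i j ∈ K) : Fintype.card ι ≤ 2 * (a • (1 : Matrix ι ι ℝ) + A).rank := by
  set AK : Matrix ι ι K := fun i j => ⟨A i j, hA i j⟩ with hAK
  have hmap : A = AK.map (algebraMap K ℝ) := by ext i j; rfl
  set Cm := a • (1 : Matrix ι ι ℝ) + A with hCm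
  -- nullity ≤ geometric multiplicity of `-a` ≤ algebraic multiplicity
  have hker : LinearMap.ker Cm.mulVecLin ≤ Module.End.eigenspace (Matrix.toLin' A) (-a) := by
    intro v hv
    rw [LinearMap.mem_ker, Matrix.mulVecLin_apply, hCm, add_mulVec, smul_mulVec, one_mulVec] at hv
    rw [Module.End.mem_eigenspace_iff, Matrix.toLin'_apply]
    have : A *ᵥ v = -(a • v) := eq_neg_of_add_eq_zero_right hv
    rw [this, neg_smul]
  have h1 : Module.finrank ℝ (LinearMap.ker Cm.mulVecLin) ≤ rootMultiplicity (-a) A.charpoly := by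
    calc Module.finrank ℝ (LinearMap.ker Cm.mulVecLin)
        ≤ Module.finrank ℝ (Module.End.eigenspace (Matrix.toLin' A) (-a)) := Submodule.finrank_mono hker
      _ ≤ Module.finrank ℝ (Module.End.maxGenEigenspace (Matrix.toLin' A) (-a)) :=
          Submodule.finrank_mono Module.End.eigenspace_le_maxGenEigenspace
      _ = rootMultiplicity (-a) (Matrix.toLin' A).charpoly := LinearMap.finrank_maxGenEigenspace_eq _ _
      _ = rootMultiplicity (-a) A.charpoly := by rw [Matrix.charpoly_toLin']
  have h2 : 2 * rootMultiplicity (-a) A.charpoly ≤ Fintype.card ι := by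
    rw [hmap, Matrix.charpoly_map]
    have := (rootMultiplicity_eq_and_le K ha ⟨a ^ 2, ha2⟩ rfl AK.charpoly (Matrix.charpoly_monic AK)).2
    rwa [Matrix.charpoly_natDegree_eq_dim] at this
  have h3 : Cm.rank + Module.finrank ℝ (LinearMap.ker Cm.mulVecLin) = Fintype.card ι := by
    have := LinearMap.finrank_range_add_finrank_ker Cm.mulVecLin
    rw [Module.finrank_fintype_fun_eq_card] at this
    exact this
  omega

/-- The `⌈N/2⌉` form of Theorem 9. [cite: LeeWei2014, Thm. 9] -/
theorem half_card_le_rank {ι : Type} [Fintype ι] [DecidableEq ι] {a : ℝ} (ha : a ∉ K) (ha2 : a ^ 2 ∈ K)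
    (A : Matrix ι ι ℝ) (hA : ∀ i j, A i j ∈ K) : (Fintype.card ι + 1) / 2 ≤ (a • (1 : Matrix ι ι ℝ) + A).rank := by
  have := card_le_two_mul_rank K ha ha2 A hA
  omega

end SquareRootRank

/-! ### §3 Lemma 10 and Definition 11: the matrices `M_n` and `P_n` -/

namespace SquareRootRank

open FixedSizePsdRank

variable {n : ℕ}

/-- **Lee–Wei's matrix `M_n`** on bit strings: `M_n(x,y) = (xᵀy − 1)(xᵀy − 2)`, `x, y ∈ {0,1}ⁿ`.
[cite: LeeWei2014, §3.1 (the matrix `M_n`)] -/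
def lwM (n : ℕ) (x y : Cube n) : ℝ := (bvec x ⬝ᵥ bvec y - 1) * (bvec x ⬝ᵥ bvec y - 2)

/-- The coefficient matrix `xxᵀ − 3·diag(x)` of the valid inequality of Lemma 10.
[cite: LeeWei2014, Lemma 10 (eq. (1))] -/
def lwCoeff (x : Cube n) : Matrix (Fin n) (Fin n) ℝ :=
  fun i j => bvec x i * bvec x j - if i = j then 3 * bvec x i else 0

/-- `⟨xxᵀ − 3 diag(x), yyᵀ⟩ = (xᵀy)² − 3 xᵀy` for `0/1` vectors `y` (`y_i² = y_i`).
[cite: LeeWei2014, Lemma 10 (proof: `Tr(xxᵀyyᵀ) = (xᵀy)²`, `Tr(diag(x) yyᵀ) = xᵀy`)] -/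
theorem flat_lwCoeff_dotProduct_vecOuter (x y : Cube n) :
    flat (lwCoeff x) ⬝ᵥ vecOuter n (bvec y) = (bvec x ⬝ᵥ bvec y) ^ 2 - 3 * (bvec x ⬝ᵥ bvec y) := by
  rw [flat_dotProduct_vecOuter]
  simp only [lwCoeff, sub_mul, Finset.sum_sub_distrib, ite_mul, zero_mul, Finset.sum_ite_eq,
    Finset.mem_univ, if_true]
  have hsq : ∀ i, bvec y i * bvec y i = bvec y i := by
    intro i; rcases bvec_zero_or_one y i with h | h <;> simp [h]
  simp only [hsq, dotProduct, pow_two, Finset.sum_mul, Finset.mul_sum]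
  congr 1
  · refine Finset.sum_congr rfl fun i _ => Finset.sum_congr rfl fun j _ => ?_; ring
  · refine Finset.sum_congr rfl fun i _ => ?_; ring

/-- **Lee–Wei Lemma 10 (the slack identity).** The inequality `⟨xxᵀ − 3 diag(x), Y⟩ + 2 ≥ 0` evaluated
at the vertex `Y = yyᵀ` of `COR_n` has slack exactly `M_n(x, y) = (xᵀy − 1)(xᵀy − 2)`.
[cite: LeeWei2014, Lemma 10] -/
theorem lwM_eq_slack (x y : Cube n) : lwM n x y = flat (lwCoeff x) ⬝ᵥ vecOuter n (bvec y) + 2 := by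
  rw [flat_lwCoeff_dotProduct_vecOuter, lwM]; ring

/-- `xᵀy` is a natural number: the number of common `1`s (tree: `FixedSizePsdRank.ip`).
[cite: LeeWei2014, §3.1] -/
theorem dotProduct_bvec_eq_ip (x y : Cube n) : bvec x ⬝ᵥ bvec y = (ip x y : ℝ) := by
  rw [dotProduct, ip_eq_sum, Nat.cast_sum]
  refine Finset.sum_congr rfl fun i _ => ?_
  by_cases hx : x i = true <;> by_cases hy : y i = true <;> simp [bvec, hx, hy]

/-- `(t − 1)(t − 2) ≥ 0` for every natural number `t` ("the polynomial `(z−1)(z−2)` is nonnegative on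
integers"). [cite: LeeWei2014, Lemma 10 (proof)] -/
private theorem sub_one_mul_sub_two_nonneg (t : ℕ) : 0 ≤ ((t : ℝ) - 1) * ((t : ℝ) - 2) := by
  rcases Nat.lt_or_ge t 2 with h | h
  · interval_cases t <;> norm_num
  · have : (2 : ℝ) ≤ t := by exact_mod_cast h
    nlinarith

/-- **Lee–Wei Lemma 10 (validity): `M_n` is a submatrix of the slack matrix of `COR_n`.** For every
`x ∈ {0,1}ⁿ` the linear inequality `⟨xxᵀ − 3 diag(x), Y⟩ + 2 ≥ 0` is valid on the correlation polytope
`COR_n = conv{yyᵀ}` (tree: `FixedSizePsdRank.corPolytope`), and its slack at the vertex `yyᵀ` is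
`M_n(x,y) ≥ 0`. [cite: LeeWei2014, Lemma 10] -/
theorem LeeWei2014_lemma10 (x : Cube n) :
    (∀ z ∈ corPolytope n, 0 ≤ flat (lwCoeff x) ⬝ᵥ z + 2) ∧
      ∀ y : Cube n, flat (lwCoeff x) ⬝ᵥ vecOuter n (bvec y) + 2 = lwM n x y := by
  refine ⟨fun z hz => ?_, fun y => (lwM_eq_slack x y).symm⟩
  have hconv : Convex ℝ {z : Fin (n * n) → ℝ | 0 ≤ flat (lwCoeff x) ⬝ᵥ z + 2} := by
    have h1 : {z : Fin (n * n) → ℝ | 0 ≤ flat (lwCoeff x) ⬝ᵥ z + 2} =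
        {z | (-2 : ℝ) ≤ (fun z => flat (lwCoeff x) ⬝ᵥ z) z} := by
      ext z; simp only [Set.mem_setOf_eq]; constructor <;> intro h <;> linarith
    rw [h1]
    refine (convex_halfSpace_ge ⟨fun a b => ?_, fun c a => ?_⟩ (-2))
    · simp only [dotProduct_add]
    · simp only [dotProduct_smul, smul_eq_mul]
  refine (convexHull_min ?_ hconv) hz
  rintro _ ⟨y, rfl⟩
  show 0 ≤ flat (lwCoeff x) ⬝ᵥ vecOuter n (bvec y) + 2
  rw [← lwM_eq_slack, lwM, dotProduct_bvec_eq_ip]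
  exact sub_one_mul_sub_two_nonneg _

/-- The index set of `P_n`: strings of Hamming weight `w` = `w`-subsets of `[n]`.
[cite: LeeWei2014, Def. 11] -/
abbrev WeightSets (n w : ℕ) : Type := {s : Finset (Fin n) // s.card = w}

/-- **Definition 11: the block `P_n`** — `M_n` restricted to strings of Hamming weight `p + 1`, written
on `(p+1)`-subsets `x, y ⊆ [n]`: `P(x,y) = (|x ∩ y| − 1)(|x ∩ y| − 2)`. [cite: LeeWei2014, Def. 11] -/
def lwP (n p : ℕ) (x y : WeightSets n (p + 1)) : ℝ :=
  (((x.1 ∩ y.1).card : ℝ) - 1) * (((x.1 ∩ y.1).card : ℝ) - 2)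

/-- `P_n` is entrywise nonnegative. [cite: LeeWei2014, Def. 11] -/
theorem lwP_nonneg {p : ℕ} (x y : WeightSets n (p + 1)) : 0 ≤ lwP n p x y :=
  sub_one_mul_sub_two_nonneg _

/-- Diagonal of `P_n`: `|x ∩ x| = p + 1`, so `P(x,x) = p(p − 1)`. [cite: LeeWei2014, Thm. 12 (proof)] -/
theorem lwP_diag {p : ℕ} (x : WeightSets n (p + 1)) :
    lwP n p x x = (p : ℝ) * ((p : ℝ) - 1) := by
  rw [lwP, Finset.inter_self, x.2]; push_cast; ring

/-- Off the diagonal `|x ∩ y| ≤ p` (two distinct `(p+1)`-sets). [cite: LeeWei2014, Thm. 12 (proof)] -/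
theorem card_inter_le {p : ℕ} {x y : WeightSets n (p + 1)} (hxy : x ≠ y) :
    (x.1 ∩ y.1).card ≤ p := by
  by_contra hlt
  have hle : (x.1 ∩ y.1).card ≤ p + 1 := (Finset.card_le_card Finset.inter_subset_left).trans x.2.le
  have heq : (x.1 ∩ y.1).card = p + 1 := by omega
  have h1 : x.1 ∩ y.1 = x.1 := Finset.eq_of_subset_of_card_le Finset.inter_subset_left (by rw [heq, x.2])
  have h2 : x.1 ∩ y.1 = y.1 := Finset.eq_of_subset_of_card_le Finset.inter_subset_right (by rw [heq, y.2])
  exact hxy (Subtype.ext (h1.symm.trans h2))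

/-- The bit string of a subset of `[n]` (weight-`w` strings ↔ `w`-subsets). [cite: LeeWei2014, Def. 11] -/
def toCube (s : Finset (Fin n)) : Cube n := fun i => decide (i ∈ s)

/-- `xᵀy = |x ∩ y|` under the identification. [cite: LeeWei2014, Def. 11] -/
theorem ip_toCube (s t : Finset (Fin n)) : ip (toCube s) (toCube t) = (s ∩ t).card := by
  unfold ip toCube
  congr 1; ext i; simp [Finset.mem_inter]

/-- `P_n` IS the submatrix of `M_n` on the weight-`(p+1)` strings. [cite: LeeWei2014, Def. 11] -/
theorem lwP_eq_lwM {p : ℕ} (x y : WeightSets n (p + 1)) :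
    lwP n p x y = lwM n (toCube x.1) (toCube y.1) := by
  rw [lwM, dotProduct_bvec_eq_ip, ip_toCube]; rfl

/-- Hence (Lemma 10) `P_n` is a submatrix of the slack matrix of `COR_n`: `P(x,y)` is the slack of the
vertex `yyᵀ` in the valid inequality `⟨xxᵀ − 3 diag(x), Y⟩ + 2 ≥ 0`. [cite: LeeWei2014, Lemma 10, Def. 11] -/
theorem lwP_eq_slack {p : ℕ} (x y : WeightSets n (p + 1)) :
    lwP n p x y = flat (lwCoeff (toCube x.1)) ⬝ᵥ vecOuter n (bvec (toCube y.1)) + 2 := by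
  rw [lwP_eq_lwM, lwM_eq_slack]

end SquareRootRank

/-! ### §4 Theorem 12: the square root rank of `P_n` is at least `⌈N/2⌉` -/

namespace SquareRootRank

variable {n : ℕ}

/-- The field `𝔽 = ℚ(√q : q prime, q < p)` of the proof of Theorem 12 (tree: `sqrtField`).
[cite: LeeWei2014, Thm. 12 (proof)] -/
def primeSqrtField (p : ℕ) : IntermediateField ℚ ℝ := sqrtField ((Finset.range p).filter Nat.Prime)

/-- `√p ∉ ℚ(√q : q prime < p)` ("see exercise 6.15 of Stewart, *Galois Theory* (3rd ed., 2004)"; tree: Besicovitch's theorem,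
`sqrt_not_mem_sqrtField`). [cite: LeeWei2014, Thm. 12 (proof); Besicovitch1940, Thm. 2] -/
theorem sqrt_prime_not_mem {p : ℕ} (hp : p.Prime) : Real.sqrt p ∉ primeSqrtField p := by
  refine sqrt_not_mem_sqrtField _ (fun q hq => (Finset.mem_filter.mp hq).2) p hp.squarefree hp.one_lt
    (fun r hr hrp hrP => ?_)
  have : r = p := (Nat.prime_dvd_prime_iff_eq hr hp).mp hrp
  have hlt := Finset.mem_range.mp (Finset.mem_filter.mp hrP).1
  omega

/-- `√t ∈ 𝔽` for every natural `t < p`. [cite: LeeWei2014, Thm. 12 (proof)] -/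
theorem sqrt_mem_of_lt {p t : ℕ} (ht : t < p) : Real.sqrt t ∈ primeSqrtField p :=
  sqrt_mem_sqrtField_primesBelow t ht

/-- The off-diagonal entries `(t−1)(t−2)`, `t ≤ p`, `p ≥ 3`, are products `u·v` of naturals `< p`, so
their square roots lie in `𝔽`. [cite: LeeWei2014, Thm. 12 (proof: "all off diagonal entries of `C`
are in `𝔽`")] -/
theorem sqrt_entry_mem {p t : ℕ} (h3 : 3 ≤ p) (ht : t ≤ p) :
    Real.sqrt (((t : ℝ) - 1) * ((t : ℝ) - 2)) ∈ primeSqrtField p := by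
  obtain ⟨u, v, hu, hv, huv⟩ : ∃ u v : ℕ, u < p ∧ v < p ∧ ((t : ℝ) - 1) * ((t : ℝ) - 2) = (u : ℝ) * v := by
    rcases Nat.lt_or_ge t 2 with h | h
    · interval_cases t
      · exact ⟨2, 1, by omega, by omega, by norm_num⟩
      · exact ⟨0, 0, by omega, by omega, by norm_num⟩
    · refine ⟨t - 1, t - 2, by omega, by omega, ?_⟩
      rw [Nat.cast_sub (by omega), Nat.cast_sub h]; norm_num
  rw [huv, Real.sqrt_mul (Nat.cast_nonneg u)]
  exact mul_mem (sqrt_mem_of_lt hu) (sqrt_mem_of_lt hv)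

/-- Real square roots: `b² = r ≥ 0` forces `b = ±√r`. [folklore] -/
private theorem eq_sqrt_or {b r : ℝ} (hr : 0 ≤ r) (h : b ^ 2 = r) : b = Real.sqrt r ∨ b = -Real.sqrt r :=
  sq_eq_sq_iff_eq_or_eq_neg.mp (by rw [h, Real.sq_sqrt hr])

/-- **Lee–Wei Theorem 12.** For a prime `p ≥ 3` every real matrix `B` with `B ∘ B = P_n` (a Hadamard
square root of the weight-`(p+1)` block of the correlation-polytope slack) has `rank B ≥ ⌈N/2⌉`,
`N = C(n, p+1)` the size of `P_n`; i.e. `rank_√(P_n) ≥ ⌈N/2⌉`. Proof as printed: rescale the rows so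
that the diagonal becomes `√p`; all other entries then lie in `𝔽 = ℚ(√q : q < p prime) ∌ √p`, and
Theorem 9 applies. (`p ≥ 3` is implicit in the text: for `p = 2` the off-diagonal entries `±√2` are
not in `𝔽 = ℚ`.) [cite: LeeWei2014, Thm. 12] -/
theorem LeeWei2014_thm12 {p : ℕ} (hp : p.Prime) (h3 : 3 ≤ p)
    (B : Matrix (WeightSets n (p + 1)) (WeightSets n (p + 1)) ℝ)
    (hB : ∀ x y, B x y ^ 2 = lwP n p x y) :
    Fintype.card (WeightSets n (p + 1)) ≤ 2 * B.rank := by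
  classical
  set F := primeSqrtField p with hF
  set a := Real.sqrt p with ha
  have ha0 : 0 < a := Real.sqrt_pos.2 (by exact_mod_cast hp.pos)
  have haF : a ∉ F := sqrt_prime_not_mem hp
  have ha2 : a ^ 2 ∈ F := by
    rw [ha, Real.sq_sqrt (Nat.cast_nonneg p)]; exact natCast_mem F p
  set c := Real.sqrt ((p : ℝ) - 1) with hc
  have hp3 : (3 : ℝ) ≤ p := by exact_mod_cast h3
  have hc0 : 0 < c := Real.sqrt_pos.2 (by linarith)
  have hcF : c ∈ F := by
    have := sqrt_mem_of_lt (p := p) (t := p - 1) (by omega)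
    rwa [Nat.cast_sub hp.one_lt.le, Nat.cast_one] at this
  -- the diagonal entries of `B` are `± a c`
  have hdiag : ∀ x, B x x = a * c ∨ B x x = -(a * c) := by
    intro x
    have h := hB x x
    rw [lwP_diag] at h
    have hac : (a * c) ^ 2 = (p : ℝ) * ((p : ℝ) - 1) := by
      rw [mul_pow, ha, hc, Real.sq_sqrt (Nat.cast_nonneg p),
        Real.sq_sqrt (by linarith)]
    exact sq_eq_sq_iff_eq_or_eq_neg.mp (by rw [h, hac])
  have hdiag0 : ∀ x, B x x ≠ 0 := by
    intro x h0
    rcases hdiag x with h | h <;> rw [h0] at h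
    · exact (mul_pos ha0 hc0).ne' h.symm
    · have : a * c = 0 := by linarith
      exact (mul_pos ha0 hc0).ne' this
  -- rescaling `d x = a / B x x = ± c⁻¹ ∈ F`
  set d : WeightSets n (p + 1) → ℝ := fun x => a / B x x with hd
  have hdF : ∀ x, d x ∈ F := by
    intro x
    rcases hdiag x with h | h
    · have : d x = c⁻¹ := by simp only [hd]; rw [h]; field_simp
      rw [this]; exact inv_mem hcF
    · have : d x = -c⁻¹ := by simp only [hd]; rw [h]; field_simp
      rw [this]; exact neg_mem (inv_mem hcF)
  -- off-diagonal entries of `B` lie in `F`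
  have hoffF : ∀ x y, x ≠ y → B x y ∈ F := by
    intro x y hxy
    have h := hB x y
    have hmem := sqrt_entry_mem h3 (card_inter_le hxy)
    rcases eq_sqrt_or (lwP_nonneg x y) h with e | e
    · rw [e]; exact hmem
    · rw [e]; exact neg_mem hmem
  -- `C = D B = a I + A` with `A` over `F`
  set Cm : Matrix (WeightSets n (p + 1)) (WeightSets n (p + 1)) ℝ := Matrix.diagonal d * B with hCm
  set Am : Matrix (WeightSets n (p + 1)) (WeightSets n (p + 1)) ℝ :=
    Cm - a • (1 : Matrix (WeightSets n (p + 1)) (WeightSets n (p + 1)) ℝ) with hAm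
  have hC : Cm = a • (1 : Matrix (WeightSets n (p + 1)) (WeightSets n (p + 1)) ℝ) + Am := by
    rw [hAm]; abel
  have hAF : ∀ x y, Am x y ∈ F := by
    intro x y
    rw [hAm, Matrix.sub_apply, Matrix.smul_apply, Matrix.one_apply, hCm, Matrix.diagonal_mul]
    by_cases hxy : x = y
    · subst hxy
      rw [if_pos rfl, smul_eq_mul, mul_one]
      have : d x * B x x - a = 0 := by simp only [hd]; field_simp [hdiag0 x]; ring
      rw [this]; exact zero_mem F
    · rw [if_neg hxy, smul_zero, sub_zero]
      exact mul_mem (hdF x) (hoffF x y hxy)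
  have hrank : Cm.rank = B.rank := by
    rw [hCm]
    refine Matrix.rank_mul_eq_right_of_isUnit_det _ _ ?_
    rw [Matrix.det_diagonal]
    exact isUnit_iff_ne_zero.2 (Finset.prod_ne_zero_iff.2 fun x _ => div_ne_zero ha0.ne' (hdiag0 x))
  have key := card_le_two_mul_rank F haF ha2 Am hAF
  rw [← hC, hrank] at key
  exact key

/-- **Theorem 12 in the language of FGPRT Def. 5.2 (`HasHadamardSqrtOfRankLE`)**: `rank_√(P_n) ≤ r`
forces `⌈N/2⌉ ≤ r`. [cite: LeeWei2014, Thm. 12; FawziEtAl2015, Def. 5.2 (p14)] -/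
theorem half_card_le_of_hasHadamardSqrtOfRankLE {p : ℕ} (hp : p.Prime) (h3 : 3 ≤ p) {r : ℕ}
    (h : HasHadamardSqrtOfRankLE (Matrix.of (lwP n p)) r) :
    (Fintype.card (WeightSets n (p + 1)) + 1) / 2 ≤ r := by
  obtain ⟨B, hB, hr⟩ := h
  have := LeeWei2014_thm12 hp h3 B (fun x y => by rw [hB]; rfl)
  omega

/-- **Rank-one psd factorisations of `P_n` are exponential** (the meaning of Theorem 12 for psd rank:
"the square root rank is an upper bound on the positive semidefinite rank … lower bounds are of interest
for … factorizations with rank-one factors"): every psd factorisation of `P_n` all of whose factors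
have rank `≤ 1` has size `≥ ⌈N/2⌉`, via FGPRT Prop. 6.2 (tree: `FawziEtAl2015_prop62_holds`).
[cite: LeeWei2014, Thm. 12 and §1; FawziEtAl2015, Prop. 6.2 (p18)] -/
theorem half_card_le_of_rankOne_psdFactorization {p : ℕ} (hp : p.Prime) (h3 : 3 ≤ p) {k : ℕ}
    (A B : WeightSets n (p + 1) → Matrix (Fin k) (Fin k) ℝ)
    (hA : ∀ i, (A i).PosSemidef ∧ (A i).rank ≤ 1) (hB : ∀ j, (B j).PosSemidef ∧ (B j).rank ≤ 1)
    (hM : ∀ i j, lwP n p i j = (A i * B j).trace) :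
    (Fintype.card (WeightSets n (p + 1)) + 1) / 2 ≤ k :=
  half_card_le_of_hasHadamardSqrtOfRankLE hp h3
    (FawziEtAl2015_prop62_holds _ _ (Matrix.of (lwP n p)) k ⟨A, B, hA, hB, fun i j => hM i j⟩)

/-- The size of `P_n` is `C(n, p+1)`. [cite: LeeWei2014, Def. 11 ("the size of `P_n` is `C(n,p+1)`")] -/
theorem card_weightSets (n w : ℕ) : Fintype.card (WeightSets n w) = n.choose w := by
  rw [Fintype.card_finset_len, Fintype.card_fin]

/-! ### The numerical corollary: `rank_√(P_n) ≥ 3^{n/3 − 1}` -/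

/-- Vandermonde: `C(m,i)·C(k,j) ≤ C(m+k, i+j)`. [folklore] -/
private theorem choose_mul_choose_le (m k i j : ℕ) : m.choose i * k.choose j ≤ (m + k).choose (i + j) := by
  rw [Nat.add_choose_eq]
  have hmem : (i, j) ∈ antidiagonal (i + j) := by simp
  exact Finset.single_le_sum (f := fun ij : ℕ × ℕ => m.choose ij.1 * k.choose ij.2)
    (fun _ _ => Nat.zero_le _) hmem

/-- `3^k ≤ C(n,k)` whenever `3k ≤ n`. [folklore] -/
private theorem three_pow_le_choose : ∀ k n : ℕ, 3 * k ≤ n → 3 ^ k ≤ n.choose k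
  | 0, n, _ => by simp
  | k + 1, n, h => by
    have hn : (n - 3) + 3 = n := by omega
    have ih := three_pow_le_choose k (n - 3) (by omega)
    calc 3 ^ (k + 1) = 3 ^ k * 3 := pow_succ 3 k
      _ ≤ (n - 3).choose k * (3 : ℕ).choose 1 := by
          rw [Nat.choose_one_right]; exact Nat.mul_le_mul_right 3 ih
      _ ≤ ((n - 3) + 3).choose (k + 1) := choose_mul_choose_le _ _ _ _
      _ = n.choose (k + 1) := by rw [hn]

/-- The binomial estimate behind "`rank_√(P_n) ≥ 3^{n/3−1}`": with `q = ⌊n/3⌋` and `a = q + 1` if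
`n ≡ 2 (mod 3)`, `a = q` otherwise, `8·3ⁿ ≤ 27·C(n,a)³`. [folklore] -/
private theorem eight_mul_three_pow_le (n : ℕ) :
    8 * 3 ^ n ≤ 27 * n.choose (if n % 3 = 2 then n / 3 + 1 else n / 3) ^ 3 := by
  split_ifs with h
  · have hn : n = 3 * (n / 3) + 2 := by omega
    have h1 : 2 * 3 ^ (n / 3) ≤ n.choose (n / 3 + 1) := by
      calc 2 * 3 ^ (n / 3) ≤ (3 * (n / 3)).choose (n / 3) * (2 : ℕ).choose 1 := by
            rw [Nat.choose_one_right, mul_comm _ 2]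
            exact Nat.mul_le_mul_left 2 (three_pow_le_choose (n / 3) _ le_rfl)
        _ ≤ (3 * (n / 3) + 2).choose (n / 3 + 1) := choose_mul_choose_le _ _ _ _
        _ = n.choose (n / 3 + 1) := by rw [← hn]
    calc 8 * 3 ^ n ≤ 8 * 3 ^ (3 * (n / 3) + 3) :=
          Nat.mul_le_mul_left _ (Nat.pow_le_pow_right (by norm_num) (by omega))
      _ = 27 * (2 * 3 ^ (n / 3)) ^ 3 := by ring
      _ ≤ 27 * n.choose (n / 3 + 1) ^ 3 := Nat.mul_le_mul_left _ (Nat.pow_le_pow_left h1 3)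
  · have h1 : 3 ^ (n / 3) ≤ n.choose (n / 3) := three_pow_le_choose _ n (by omega)
    calc 8 * 3 ^ n ≤ 8 * 3 ^ (3 * (n / 3) + 1) :=
          Nat.mul_le_mul_left _ (Nat.pow_le_pow_right (by norm_num) (by omega))
      _ = 24 * (3 ^ (n / 3)) ^ 3 := by ring
      _ ≤ 27 * (3 ^ (n / 3)) ^ 3 := Nat.mul_le_mul_right _ (by norm_num)
      _ ≤ 27 * n.choose (n / 3) ^ 3 := Nat.mul_le_mul_left _ (Nat.pow_le_pow_left h1 3)

/-- Binomial coefficients increase up to the middle. [folklore] -/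
private theorem choose_le_choose_of_le_half {n a b : ℕ} (hab : a ≤ b) (hb : b ≤ n / 2) :
    n.choose a ≤ n.choose b := by
  induction b, hab using Nat.le_induction with
  | base => exact le_rfl
  | succ b hab ih => exact (ih (by omega)).trans (Nat.choose_le_succ_of_lt_half_left (by omega))

/-- `C(n,a) ≤ C(n,K)` for `a ≤ K ≤ n − a`. [folklore] -/
private theorem choose_le_choose_middle {n a K : ℕ} (haK : a ≤ K) (hK : K ≤ n - a) :
    n.choose a ≤ n.choose K := by
  rcases Nat.lt_or_ge (n / 2) K with h | h
  · rw [← Nat.choose_symm (show K ≤ n by omega)]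
    exact choose_le_choose_of_le_half (by omega) (by omega)
  · exact choose_le_choose_of_le_half haK h

/-- **Theorem 12, "in particular `rank_√(P_n) ≥ 3^{n/3−1}`" — the paper's main result** (§1: "a lower
bound of `3^{n/3−1}` on the square root rank of the slack matrix of `COR_n`"). Typed for `n ≥ 6`, with
the prime supplied by Bertrand's postulate in `(⌊n/3⌋, 2⌊n/3⌋]` (the paper fixes "the prime closest to
`n/2`" in Def. 11 and invokes Bertrand for the count; every prime `p ≥ 3` with `⌊n/3⌋+1 ≤ p+1 ≤ n−⌊n/3⌋−1`
works by the same monotonicity-of-binomials count `C(n,p+1) ≥ C(n,⌈n/3⌉)`), and with `3^{n/3−1} ≤ rank B`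
written free of real exponents as `3ⁿ ≤ (3·rank B)³`. [cite: LeeWei2014, Thm. 12, Def. 11] -/
theorem LeeWei2014_thm12_exp {n : ℕ} (hn : 6 ≤ n) :
    ∃ p : ℕ, p.Prime ∧ 3 ≤ p ∧ p + 1 ≤ n ∧
      ∀ B : Matrix (WeightSets n (p + 1)) (WeightSets n (p + 1)) ℝ,
        (∀ x y, B x y ^ 2 = lwP n p x y) → 3 ^ n ≤ (3 * B.rank) ^ 3 := by
  obtain ⟨p, hp, hqp, hp2q⟩ := Nat.exists_prime_lt_and_le_two_mul (n / 3) (by omega)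
  have hp3 : 3 ≤ p := by omega
  have hpodd : p ≠ 2 * (n / 3) := by
    intro h
    rcases hp.eq_one_or_self_of_dvd 2 ⟨n / 3, h⟩ with h2 | h2 <;> omega
  refine ⟨p, hp, hp3, by omega, fun B hB => ?_⟩
  have hN := LeeWei2014_thm12 hp hp3 B hB
  rw [card_weightSets] at hN
  have hmono : n.choose (if n % 3 = 2 then n / 3 + 1 else n / 3) ≤ n.choose (p + 1) := by
    split_ifs with h
    · exact choose_le_choose_middle (by omega) (by omega)
    · exact choose_le_choose_middle (by omega) (by omega)
  have key : 8 * 3 ^ n ≤ 8 * (3 * B.rank) ^ 3 :=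
    calc 8 * 3 ^ n ≤ 27 * n.choose (if n % 3 = 2 then n / 3 + 1 else n / 3) ^ 3 :=
          eight_mul_three_pow_le n
      _ ≤ 27 * n.choose (p + 1) ^ 3 := Nat.mul_le_mul_left _ (Nat.pow_le_pow_left hmono 3)
      _ ≤ 27 * (2 * B.rank) ^ 3 := Nat.mul_le_mul_left _ (Nat.pow_le_pow_left hN 3)
      _ = 8 * (3 * B.rank) ^ 3 := by ring
  exact Nat.le_of_mul_le_mul_left key (by norm_num)

/-- The same corollary in the printed form `rank B ≥ 3^{n/3 − 1}` (real exponent).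
[cite: LeeWei2014, Thm. 12] -/
theorem LeeWei2014_thm12_rpow {n : ℕ} (hn : 6 ≤ n) :
    ∃ p : ℕ, p.Prime ∧ 3 ≤ p ∧ p + 1 ≤ n ∧
      ∀ B : Matrix (WeightSets n (p + 1)) (WeightSets n (p + 1)) ℝ,
        (∀ x y, B x y ^ 2 = lwP n p x y) → (3 : ℝ) ^ ((n : ℝ) / 3 - 1) ≤ B.rank := by
  obtain ⟨p, hp, hp3, hpn, h⟩ := LeeWei2014_thm12_exp hn
  refine ⟨p, hp, hp3, hpn, fun B hB => ?_⟩
  have h2 : (3 : ℝ) ^ n ≤ ((3 * B.rank : ℕ) : ℝ) ^ 3 := by exact_mod_cast h B hB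
  have h3 : ((3 : ℝ) ^ ((n : ℝ) / 3)) ^ 3 = (3 : ℝ) ^ n := by
    rw [← Real.rpow_natCast _ 3, ← Real.rpow_mul (by norm_num : (0:ℝ) ≤ 3), ← Real.rpow_natCast 3 n]
    congr 1; push_cast; ring
  have h4 : (3 : ℝ) ^ ((n : ℝ) / 3) ≤ ((3 * B.rank : ℕ) : ℝ) := by
    rw [← pow_le_pow_iff_left₀ (by positivity) (by positivity) three_ne_zero, h3]; exact h2
  rw [Real.rpow_sub (by norm_num), Real.rpow_one, div_le_iff₀ (by norm_num)]
  calc (3 : ℝ) ^ ((n : ℝ) / 3) ≤ ((3 * B.rank : ℕ) : ℝ) := h4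
    _ = (B.rank : ℝ) * 3 := by push_cast; ring

/-- `HasHadamardSqrtOfRankLE` form of the exponential corollary: `rank_√(P_n) ≤ r ⇒ 3ⁿ ≤ (3r)³`.
[cite: LeeWei2014, Thm. 12; FawziEtAl2015, Def. 5.2 (p14)] -/
theorem LeeWei2014_thm12_exp' {n : ℕ} (hn : 6 ≤ n) :
    ∃ p : ℕ, p.Prime ∧ 3 ≤ p ∧ p + 1 ≤ n ∧
      ∀ r : ℕ, HasHadamardSqrtOfRankLE (Matrix.of (lwP n p)) r → 3 ^ n ≤ (3 * r) ^ 3 := by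
  obtain ⟨p, hp, hp3, hpn, h⟩ := LeeWei2014_thm12_exp hn
  refine ⟨p, hp, hp3, hpn, fun r ⟨B, hB, hr⟩ => ?_⟩
  exact (h B fun x y => by rw [hB]; rfl).trans (Nat.pow_le_pow_left (Nat.mul_le_mul_left 3 hr) 3)

/-! ### §5 Perspective: the matrix `F_n(x,y) = xᵀy(xᵀy − 1)` — exponential square root rank, but
nonnegative (hence psd) rank at most `C(n,2)` -/

open FixedSizePsdRank

/-- **The engine of Theorems 12/13, abstracted**: a real square matrix whose diagonal entries square to
`p(p−1)` (`p` prime) and whose off-diagonal entries lie in `𝔽 = ℚ(√q : q prime, q < p)` has rank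
`≥ ⌈N/2⌉` — rescale the rows by `±1/√(p−1) ∈ 𝔽` to make the diagonal `√p ∉ 𝔽` and apply Theorem 9.
[cite: LeeWei2014, Thm. 12 (proof) and Thm. 13 (proof)] -/
theorem card_le_two_mul_rank_of_prime {ι : Type} [Fintype ι] [DecidableEq ι] {p : ℕ} (hp : p.Prime)
    (B : Matrix ι ι ℝ) (hdiagsq : ∀ x, B x x ^ 2 = (p : ℝ) * ((p : ℝ) - 1))
    (hoffF : ∀ x y, x ≠ y → B x y ∈ primeSqrtField p) : Fintype.card ι ≤ 2 * B.rank := by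
  classical
  set F := primeSqrtField p with hF
  set a := Real.sqrt p with ha
  have ha0 : 0 < a := Real.sqrt_pos.2 (by exact_mod_cast hp.pos)
  have haF : a ∉ F := sqrt_prime_not_mem hp
  have ha2 : a ^ 2 ∈ F := by
    rw [ha, Real.sq_sqrt (Nat.cast_nonneg p)]; exact natCast_mem F p
  set c := Real.sqrt ((p : ℝ) - 1) with hc
  have hp1 : (0 : ℝ) < (p : ℝ) - 1 := by
    have : (2 : ℝ) ≤ p := by exact_mod_cast hp.two_le
    linarith
  have hc0 : 0 < c := Real.sqrt_pos.2 hp1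
  have hcF : c ∈ F := by
    have := sqrt_mem_of_lt (p := p) (t := p - 1) (by have := hp.one_lt; omega)
    rwa [Nat.cast_sub hp.one_lt.le, Nat.cast_one] at this
  -- the diagonal entries of `B` are `± a c`
  have hdiag : ∀ x, B x x = a * c ∨ B x x = -(a * c) := by
    intro x
    have hac : (a * c) ^ 2 = (p : ℝ) * ((p : ℝ) - 1) := by
      rw [mul_pow, ha, hc, Real.sq_sqrt (Nat.cast_nonneg p), Real.sq_sqrt hp1.le]
    exact sq_eq_sq_iff_eq_or_eq_neg.mp (by rw [hdiagsq x, hac])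
  have hdiag0 : ∀ x, B x x ≠ 0 := by
    intro x h0
    rcases hdiag x with h | h <;> rw [h0] at h
    · exact (mul_pos ha0 hc0).ne' h.symm
    · have : a * c = 0 := by linarith
      exact (mul_pos ha0 hc0).ne' this
  -- rescaling `d x = a / B x x = ± c⁻¹ ∈ F`
  set d : ι → ℝ := fun x => a / B x x with hd
  have hdF : ∀ x, d x ∈ F := by
    intro x
    rcases hdiag x with h | h
    · have : d x = c⁻¹ := by simp only [hd]; rw [h]; field_simp
      rw [this]; exact inv_mem hcF
    · have : d x = -c⁻¹ := by simp only [hd]; rw [h]; field_simp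
      rw [this]; exact neg_mem (inv_mem hcF)
  set Cm : Matrix ι ι ℝ := Matrix.diagonal d * B with hCm
  set Am : Matrix ι ι ℝ := Cm - a • (1 : Matrix ι ι ℝ) with hAm
  have hC : Cm = a • (1 : Matrix ι ι ℝ) + Am := by rw [hAm]; abel
  have hAF : ∀ x y, Am x y ∈ F := by
    intro x y
    rw [hAm, Matrix.sub_apply, Matrix.smul_apply, Matrix.one_apply, hCm, Matrix.diagonal_mul]
    by_cases hxy : x = y
    · subst hxy
      rw [if_pos rfl, smul_eq_mul, mul_one]
      have : d x * B x x - a = 0 := by simp only [hd]; field_simp [hdiag0 x]; ring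
      rw [this]; exact zero_mem F
    · rw [if_neg hxy, smul_zero, sub_zero]
      exact mul_mem (hdF x) (hoffF x y hxy)
  have hrank : Cm.rank = B.rank := by
    rw [hCm]
    refine Matrix.rank_mul_eq_right_of_isUnit_det _ _ ?_
    rw [Matrix.det_diagonal]
    exact isUnit_iff_ne_zero.2 (Finset.prod_ne_zero_iff.2 fun x _ => div_ne_zero ha0.ne' (hdiag0 x))
  have key := card_le_two_mul_rank F haF ha2 Am hAF
  rw [← hC, hrank] at key
  exact key

/-- **The matrix `F_n`**: "`F_n(x,y) = xᵀy(xᵀy − 1)`", `x, y ∈ {0,1}ⁿ`. [cite: LeeWei2014, §5] -/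
def lwF (n : ℕ) (x y : Cube n) : ℝ := (bvec x ⬝ᵥ bvec y) * (bvec x ⬝ᵥ bvec y - 1)

/-- The coefficient matrix `xxᵀ − diag(x)` of the valid inequality behind `F_n` ("a very similar proof
to Lemma 10"). [cite: LeeWei2014, §5] -/
def lwFCoeff (x : Cube n) : Matrix (Fin n) (Fin n) ℝ :=
  fun i j => bvec x i * bvec x j - if i = j then bvec x i else 0

/-- `⟨xxᵀ − diag(x), yyᵀ⟩ = (xᵀy)² − xᵀy`. [cite: LeeWei2014, §5 (with Lemma 10's identities)] -/
theorem flat_lwFCoeff_dotProduct_vecOuter (x y : Cube n) :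
    flat (lwFCoeff x) ⬝ᵥ vecOuter n (bvec y) = (bvec x ⬝ᵥ bvec y) ^ 2 - (bvec x ⬝ᵥ bvec y) := by
  rw [flat_dotProduct_vecOuter]
  simp only [lwFCoeff, sub_mul, Finset.sum_sub_distrib, ite_mul, zero_mul, Finset.sum_ite_eq,
    Finset.mem_univ, if_true]
  have hsq : ∀ i, bvec y i * bvec y i = bvec y i := by
    intro i; rcases bvec_zero_or_one y i with h | h <;> simp [h]
  simp only [hsq, dotProduct, pow_two, Finset.sum_mul, Finset.mul_sum]
  congr 1
  refine Finset.sum_congr rfl fun i _ => Finset.sum_congr rfl fun j _ => ?_; ring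

/-- `F_n(x,y)` is the slack of the vertex `yyᵀ` in `⟨xxᵀ − diag(x), Y⟩ ≥ 0`. [cite: LeeWei2014, §5] -/
theorem lwF_eq_slack (x y : Cube n) : lwF n x y = flat (lwFCoeff x) ⬝ᵥ vecOuter n (bvec y) := by
  rw [flat_lwFCoeff_dotProduct_vecOuter, lwF]; ring

/-- `t(t − 1) ≥ 0` on naturals. [cite: LeeWei2014, §5] -/
private theorem mul_sub_one_nonneg (t : ℕ) : 0 ≤ (t : ℝ) * ((t : ℝ) - 1) := by
  rcases Nat.eq_zero_or_pos t with h | h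
  · subst h; norm_num
  · have : (1 : ℝ) ≤ t := by exact_mod_cast h
    exact mul_nonneg (by linarith) (by linarith)

/-- **"`F_n` is also a slack matrix of the correlation polytope"**: the inequality `⟨xxᵀ − diag(x), Y⟩ ≥ 0`
is valid on `COR_n` and its slack at the vertex `yyᵀ` is `F_n(x,y)`. [cite: LeeWei2014, §5] -/
theorem LeeWei2014_sec5_slack (x : Cube n) :
    (∀ z ∈ corPolytope n, 0 ≤ flat (lwFCoeff x) ⬝ᵥ z) ∧
      ∀ y : Cube n, flat (lwFCoeff x) ⬝ᵥ vecOuter n (bvec y) = lwF n x y := by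
  refine ⟨fun z hz => ?_, fun y => (lwF_eq_slack x y).symm⟩
  have hconv : Convex ℝ {z : Fin (n * n) → ℝ | 0 ≤ flat (lwFCoeff x) ⬝ᵥ z} := by
    have h1 : {z : Fin (n * n) → ℝ | 0 ≤ flat (lwFCoeff x) ⬝ᵥ z} =
        {z | (0 : ℝ) ≤ (fun z => flat (lwFCoeff x) ⬝ᵥ z) z} := rfl
    rw [h1]
    refine (convex_halfSpace_ge ⟨fun a b => ?_, fun c a => ?_⟩ 0)
    · simp only [dotProduct_add]
    · simp only [dotProduct_smul, smul_eq_mul]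
  refine (convexHull_min ?_ hconv) hz
  rintro _ ⟨y, rfl⟩
  show 0 ≤ flat (lwFCoeff x) ⬝ᵥ vecOuter n (bvec y)
  rw [← lwF_eq_slack, lwF, dotProduct_bvec_eq_ip]
  exact mul_sub_one_nonneg _

/-- The weight-`w` block of `F_n` on `w`-subsets: `F(x,y) = |x ∩ y|(|x ∩ y| − 1)` (the analogue of `P_n`;
for the square-root-rank bound below one takes `w = p` prime). [cite: LeeWei2014, §5 ("the proof [of]
Theorem 12 can be simply modified to show that `F_n` has exponential square root rank")] -/
def lwFP (n w : ℕ) (x y : WeightSets n w) : ℝ :=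
  ((x.1 ∩ y.1).card : ℝ) * (((x.1 ∩ y.1).card : ℝ) - 1)

/-- `lwFP` is the said submatrix of `F_n`. [cite: LeeWei2014, §5] -/
theorem lwFP_eq_lwF {w : ℕ} (x y : WeightSets n w) : lwFP n w x y = lwF n (toCube x.1) (toCube y.1) := by
  rw [lwF, dotProduct_bvec_eq_ip, ip_toCube]; rfl

/-- Two distinct `w`-sets meet in fewer than `w` points ("all off diagonal entries … `s` … strictly
smaller than `p`"). [cite: LeeWei2014, Thm. 12 (proof)] -/
theorem card_inter_lt_of_ne {w : ℕ} {x y : WeightSets n w} (hxy : x ≠ y) : (x.1 ∩ y.1).card < w := by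
  by_contra hlt
  have hle : (x.1 ∩ y.1).card ≤ w := (Finset.card_le_card Finset.inter_subset_left).trans x.2.le
  have heq : (x.1 ∩ y.1).card = w := by omega
  have h1 : x.1 ∩ y.1 = x.1 := Finset.eq_of_subset_of_card_le Finset.inter_subset_left (by rw [heq, x.2])
  have h2 : x.1 ∩ y.1 = y.1 := Finset.eq_of_subset_of_card_le Finset.inter_subset_right (by rw [heq, y.2])
  exact hxy (Subtype.ext (h1.symm.trans h2))

/-- **`F_n` has exponential square root rank** ("the proof [of] Theorem 12 can be simply modified"): for a
prime `p`, every `B` with `B ∘ B =` the weight-`p` block of `F_n` has `C(n,p) ≤ 2·rank B` — the diagonal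
is `p(p−1)`, and off the diagonal `t(t−1)` with `t = |x ∩ y| ≤ p − 1`, so `√(t(t−1)) = √t·√(t−1) ∈ 𝔽`.
(The modification: weight `p` instead of `p + 1`; here every prime `p`, also `p = 2`, works.)
[cite: LeeWei2014, §5] -/
theorem LeeWei2014_sec5_sqrtRank {p : ℕ} (hp : p.Prime) (B : Matrix (WeightSets n p) (WeightSets n p) ℝ)
    (hB : ∀ x y, B x y ^ 2 = lwFP n p x y) : Fintype.card (WeightSets n p) ≤ 2 * B.rank := by
  classical
  refine card_le_two_mul_rank_of_prime hp B (fun x => ?_) (fun x y hxy => ?_)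
  · rw [hB, lwFP, Finset.inter_self, x.2]
  · have ht := card_inter_lt_of_ne hxy
    set t := (x.1 ∩ y.1).card with htdef
    have hmem : Real.sqrt ((t : ℝ) * ((t : ℝ) - 1)) ∈ primeSqrtField p := by
      rcases Nat.eq_zero_or_pos t with h0 | h0
      · rw [h0]; simp
      · have hcast : (t : ℝ) * ((t : ℝ) - 1) = (t : ℝ) * ((t - 1 : ℕ) : ℝ) := by
          rw [Nat.cast_sub h0, Nat.cast_one]
        rw [hcast, Real.sqrt_mul (Nat.cast_nonneg t)]
        exact mul_mem (sqrt_mem_of_lt ht) (sqrt_mem_of_lt (by omega))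
    have h := hB x y
    rw [lwFP, ← htdef] at h
    rcases eq_sqrt_or (mul_sub_one_nonneg t) h with e | e
    · rw [e]; exact hmem
    · rw [e]; exact neg_mem hmem

/-- `HasHadamardSqrtOfRankLE` form: `rank_√` of the weight-`p` block of `F_n` is `≥ ⌈C(n,p)/2⌉`.
[cite: LeeWei2014, §5; FawziEtAl2015, Def. 5.2 (p14)] -/
theorem LeeWei2014_sec5_sqrtRank' {p : ℕ} (hp : p.Prime) {r : ℕ}
    (h : HasHadamardSqrtOfRankLE (Matrix.of (lwFP n p)) r) : (n.choose p + 1) / 2 ≤ r := by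
  obtain ⟨B, hB, hr⟩ := h
  have := LeeWei2014_sec5_sqrtRank hp B (fun x y => by rw [hB]; rfl)
  rw [card_weightSets] at this
  omega

/-- `F_n(x,y) = 2·C(xᵀy, 2)` (it counts ordered pairs of common `1`s). [cite: LeeWei2014, §5 (Prop. 15)] -/
theorem lwF_eq_two_mul_choose (x y : Cube n) : lwF n x y = 2 * ((ip x y).choose 2 : ℝ) := by
  rw [lwF, dotProduct_bvec_eq_ip, Nat.cast_choose_two]; ring

/-- The support of a bit string. [cite: LeeWei2014, §5] -/
def supp (x : Cube n) : Finset (Fin n) := Finset.univ.filter fun i => x i = true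

/-- `xᵀy = |supp x ∩ supp y|`. [cite: LeeWei2014, §5] -/
theorem ip_eq_card_supp_inter (x y : Cube n) : ip x y = (supp x ∩ supp y).card := by
  unfold ip supp
  congr 1; ext i; simp [Finset.mem_filter, Finset.mem_inter]

/-- Counting the `2`-subsets of `[n]` inside `T`: `#{S : |S| = 2, S ⊆ T} = C(|T|, 2)`. [folklore] -/
private theorem sum_weightSets_two_indicator (T : Finset (Fin n)) (c : ℝ) :
    ∑ S : WeightSets n 2, (if S.1 ⊆ T then c else 0) = c * (T.card.choose 2 : ℕ) := by
  rw [← Finset.sum_subtype (univ.filter fun s : Finset (Fin n) => s.card = 2) (by simp)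
    (fun s : Finset (Fin n) => if s ⊆ T then c else 0)]
  rw [Finset.sum_ite, Finset.sum_const_zero, add_zero, Finset.sum_const, nsmul_eq_mul, mul_comm]
  congr 2
  rw [← Finset.card_powersetCard 2 T]
  congr 1
  ext S
  simp only [Finset.mem_filter, Finset.mem_univ, true_and, Finset.mem_powersetCard]
  tauto

/-- **Lee–Wei Proposition 15: `rank_+(F_n) ≤ C(n, 2)`.** The text proves it by the recursion
`F_{n+1} = [[F_n, F_n], [F_n, F_n + D_n]]`; typed by the (shorter) explicit factorization it unrolls to:
`F_n(x,y) = Σ_{|S|=2} [S ⊆ x]·2[S ⊆ y]`, a sum of `C(n,2)` nonnegative rank-one matrices.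
[cite: LeeWei2014, Prop. 15] -/
theorem LeeWei2014_prop15 (n : ℕ) : HasNonnegFactorization (lwF n) (n.choose 2) := by
  classical
  let e : WeightSets n 2 ≃ Fin (n.choose 2) := Fintype.equivFinOfCardEq (card_weightSets n 2)
  refine ⟨fun x l => if (e.symm l).1 ⊆ supp x then 1 else 0,
    fun l y => if (e.symm l).1 ⊆ supp y then 2 else 0,
    fun x l => by positivity, fun l y => by positivity, fun x y => ?_⟩
  rw [lwF_eq_two_mul_choose, ip_eq_card_supp_inter]
  have hsum : ∑ l : Fin (n.choose 2),
      ((if (e.symm l).1 ⊆ supp x then (1 : ℝ) else 0) * if (e.symm l).1 ⊆ supp y then 2 else 0) =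
      ∑ S : WeightSets n 2, (if S.1 ⊆ supp x ∩ supp y then (2 : ℝ) else 0) := by
    rw [← e.symm.sum_comp]
    refine Finset.sum_congr rfl fun l _ => ?_
    by_cases hx : (e.symm l).1 ⊆ supp x <;> by_cases hy : (e.symm l).1 ⊆ supp y <;>
      simp [hx, hy, Finset.subset_inter_iff]
  rw [hsum, sum_weightSets_two_indicator]

/-- A nonnegative factorization is a psd factorization by diagonal matrices (Fact 4, "`rank_psd(A) ≤
rank_+(A)` … a nonnegative rank factorization corresponds to a PSD-factorization by diagonal
matricies"). [cite: LeeWei2014, Fact 4 (§2.2)] -/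
theorem hasPsdFactorization_of_hasNonnegFactorization {ι κ : Type*} {M : ι → κ → ℝ} {r : ℕ}
    (h : HasNonnegFactorization M r) : HasPsdFactorization M r := by
  obtain ⟨U, V, hU, hV, hM⟩ := h
  refine ⟨fun i => Matrix.diagonal (U i), fun j => Matrix.diagonal fun l => V l j,
    fun i => Matrix.posSemidef_diagonal_iff.2 (hU i), fun j => Matrix.posSemidef_diagonal_iff.2 fun l => hV l j,
    fun i j => ?_⟩
  rw [hM, Matrix.diagonal_mul_diagonal, Matrix.trace_diagonal]

/-- Hence "the PSD-rank of `F_n` is small": `rank_psd(F_n) ≤ C(n,2)`. [cite: LeeWei2014, §5 (Prop. 15 with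
Fact 4)] -/
theorem hasPsdFactorization_lwF (n : ℕ) : HasPsdFactorization (lwF n) (n.choose 2) :=
  hasPsdFactorization_of_hasNonnegFactorization (LeeWei2014_prop15 n)

/-- **The separation of §5** ("the difficulties of generalizing our approach to show lower bounds on the
PSD-rank itself"): for every prime `p` the weight-`p` block of `F_n` — a submatrix of the slack matrix of
`COR_n` — has square root rank `≥ ⌈C(n,p)/2⌉` but a psd (indeed nonnegative) factorization of size
`C(n,2)`. [cite: LeeWei2014, §5 (Prop. 15 and the preceding paragraph)] -/
theorem LeeWei2014_sec5_separation {p : ℕ} (hp : p.Prime) :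
    (∀ r, HasHadamardSqrtOfRankLE (Matrix.of (lwFP n p)) r → (n.choose p + 1) / 2 ≤ r) ∧
      HasNonnegFactorization (lwFP n p) (n.choose 2) ∧ HasPsdFactorization (lwFP n p) (n.choose 2) := by
  have hnn : HasNonnegFactorization (lwFP n p) (n.choose 2) := by
    obtain ⟨U, V, hU, hV, hM⟩ := LeeWei2014_prop15 n
    refine ⟨fun x l => U (toCube x.1) l, fun l y => V l (toCube y.1), fun x l => hU _ l,
      fun l y => hV l _, fun x y => ?_⟩
    rw [lwFP_eq_lwF, hM]
  exact ⟨fun r h => LeeWei2014_sec5_sqrtRank' hp h, hnn, hasPsdFactorization_of_hasNonnegFactorization hnn⟩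


/-! ### §4 Theorem 13: an extension to rational-weighted decompositions `P_n = Σ_j (B_j ∘ √P_n)^{∘2}` -/

open FixedSizePsdRank Kronecker

/-! #### Lemma 14: pairwise anticommuting integral involutions `σ_1, …, σ_ℓ` of size `4^{⌈ℓ/2⌉}` -/

/-- "Real versions of the Pauli matrices": `X`. [cite: LeeWei2014, Lemma 14 (proof)] -/
def pX : Matrix (Fin 4) (Fin 4) ℤ := !![0, 0, 1, 0; 0, 0, 0, 1; 1, 0, 0, 0; 0, 1, 0, 0]

/-- "Real versions of the Pauli matrices": `Y`. [cite: LeeWei2014, Lemma 14 (proof)] -/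
def pY : Matrix (Fin 4) (Fin 4) ℤ := !![0, 0, 0, 1; 0, 0, -1, 0; 0, -1, 0, 0; 1, 0, 0, 0]

/-- "Real versions of the Pauli matrices": `Z`. [cite: LeeWei2014, Lemma 14 (proof)] -/
def pZ : Matrix (Fin 4) (Fin 4) ℤ := !![1, 0, 0, 0; 0, 1, 0, 0; 0, 0, -1, 0; 0, 0, 0, -1]

/-- "They satisfy `XY = −YX`, `XZ = −ZX`, `YZ = −ZY` and `X² = Y² = Z² = I₄`."
[cite: LeeWei2014, Lemma 14 (proof)] -/
theorem pauli_relations : pX * pY = -(pY * pX) ∧ pX * pZ = -(pZ * pX) ∧ pY * pZ = -(pZ * pY) ∧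
    pX * pX = 1 ∧ pY * pY = 1 ∧ pZ * pZ = 1 := by
  decide

/-- Tensor words `M_0 ⊗ M_1 ⊗ ⋯ ⊗ M_{m−1}` of `4 × 4` matrices, as matrices on `[4]^m`:
`(⊗_i M_i)(x,y) = ∏_i M_i(x_i, y_i)`. [cite: LeeWei2014, Lemma 14 (proof: `Z^{⊗j} ⊗ Y ⊗ I^{⊗…}`)] -/
def tens {m : ℕ} {R : Type} [CommRing R] (M : Fin m → Matrix (Fin 4) (Fin 4) R) :
    Matrix (Fin m → Fin 4) (Fin m → Fin 4) R :=
  Matrix.of fun x y => ∏ i, M i (x i) (y i)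

/-- Tensor words multiply factorwise. [cite: LeeWei2014, Lemma 14 (proof)] -/
theorem tens_mul {m : ℕ} {R : Type} [CommRing R] (M N : Fin m → Matrix (Fin 4) (Fin 4) R) :
    tens M * tens N = tens (fun i => M i * N i) := by
  ext x y
  simp only [tens, Matrix.mul_apply, Matrix.of_apply]
  rw [Finset.prod_univ_sum, Fintype.piFinset_univ]
  refine Finset.sum_congr rfl fun z _ => ?_
  rw [Finset.prod_mul_distrib]

/-- The empty-pattern word is the identity. [cite: LeeWei2014, Lemma 14 (proof)] -/
theorem tens_one {m : ℕ} {R : Type} [CommRing R] :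
    tens (fun _ : Fin m => (1 : Matrix (Fin 4) (Fin 4) R)) = 1 := by
  ext x y
  simp only [tens, Matrix.of_apply, Matrix.one_apply]
  by_cases h : x = y
  · subst h; simp
  · rw [if_neg h]
    obtain ⟨i, hi⟩ := Function.ne_iff.mp h
    exact Finset.prod_eq_zero (Finset.mem_univ i) (if_neg hi)

/-- Negating one factor negates the word. [cite: LeeWei2014, Lemma 14 (proof)] -/
theorem tens_update_neg {m : ℕ} {R : Type} [CommRing R] (M : Fin m → Matrix (Fin 4) (Fin 4) R)
    (j : Fin m) : tens (Function.update M j (-M j)) = -tens M := by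
  ext x y
  simp only [tens, Matrix.of_apply, Matrix.neg_apply]
  rw [← Finset.mul_prod_erase Finset.univ _ (Finset.mem_univ j),
    ← Finset.mul_prod_erase Finset.univ (fun i => M i (x i) (y i)) (Finset.mem_univ j)]
  rw [Function.update_self, Matrix.neg_apply, neg_mul]
  congr 2
  exact Finset.prod_congr rfl fun i hi => by rw [Function.update_of_ne (Finset.ne_of_mem_erase hi)]

/-- Two words that agree except for a sign in one factor. [cite: LeeWei2014, Lemma 14 (proof)] -/
private theorem tens_eq_neg_of_pointwise {m : ℕ} {R : Type} [CommRing R]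
    (W₁ W₂ : Fin m → Matrix (Fin 4) (Fin 4) R) (i₀ : Fin m) (h0 : W₁ i₀ = -W₂ i₀)
    (h1 : ∀ i, i ≠ i₀ → W₁ i = W₂ i) : tens W₁ = -tens W₂ := by
  rw [← tens_update_neg]
  congr 1
  funext i
  by_cases hi : i = i₀
  · subst hi; rw [Function.update_self, h0]
  · rw [Function.update_of_ne hi, h1 i hi]

/-- The words of Lemma 14: `σ_{(j, X)} = Z^{⊗j} ⊗ X ⊗ I^{⊗(m−j−1)}` (`b = false`) and
`σ_{(j, Y)} = Z^{⊗j} ⊗ Y ⊗ I^{⊗(m−j−1)}` (`b = true`) — the printed `σ_{2j}`, `σ_{2j+1}`.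
[cite: LeeWei2014, Lemma 14 (proof)] -/
def sigmaWord (m : ℕ) (jb : Fin m × Bool) : Fin m → Matrix (Fin 4) (Fin 4) ℤ :=
  fun i => if i.1 < jb.1.1 then pZ else if i.1 = jb.1.1 then (if jb.2 then pY else pX) else 1

/-- **The matrices `σ_1, …, σ_{2m}` of Lemma 14** (integral, of size `4^m`), indexed by
(position, `X`/`Y`). [cite: LeeWei2014, Lemma 14] -/
def sigma (m : ℕ) (jb : Fin m × Bool) : Matrix (Fin m → Fin 4) (Fin m → Fin 4) ℤ := tens (sigmaWord m jb)

/-- "`σ_i² = I`". [cite: LeeWei2014, Lemma 14 (proof)] -/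
theorem sigma_mul_self {m : ℕ} (jb : Fin m × Bool) : sigma m jb * sigma m jb = 1 := by
  obtain ⟨j, b⟩ := jb
  rw [sigma, tens_mul, ← tens_one]
  congr 1
  funext i
  simp only [sigmaWord]
  split_ifs <;> cases b <;> decide

/-- "Any `σ_i, σ_j` for `i ≠ j` anti-commute". [cite: LeeWei2014, Lemma 14 (proof)] -/
theorem sigma_anticomm {m : ℕ} {jb jb' : Fin m × Bool} (h : jb ≠ jb') :
    sigma m jb * sigma m jb' = -(sigma m jb' * sigma m jb) := by
  obtain ⟨j, b⟩ := jb
  obtain ⟨j', b'⟩ := jb'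
  rw [sigma, sigma, tens_mul, tens_mul]
  by_cases hjj : j = j'
  · subst hjj
    have hbb : b ≠ b' := fun hb => h (by rw [hb])
    refine tens_eq_neg_of_pointwise _ _ j ?_ ?_
    · cases b <;> cases b' <;>
        first
        | exact absurd rfl hbb
        | (simp only [sigmaWord, Bool.false_eq_true, if_true, if_false]
           split_ifs <;> first | decide | (exfalso; omega))
    · intro i hi
      have hi' : i.1 ≠ j.1 := fun e => hi (Fin.ext e)
      simp only [sigmaWord, if_neg hi']
  · have hne : j.1 ≠ j'.1 := fun e => hjj (Fin.ext e)
    rcases Nat.lt_or_gt_of_ne hne with hlt | hgt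
    · refine tens_eq_neg_of_pointwise _ _ j ?_ ?_
      · cases b <;>
          (simp only [sigmaWord, Bool.false_eq_true, if_true, if_false]
           split_ifs <;> first | decide | (exfalso; omega))
      · intro i hi
        have hi' : i.1 ≠ j.1 := fun e => hi (Fin.ext e)
        simp only [sigmaWord, if_neg hi']
        split_ifs <;> first | rfl | (simp only [one_mul, mul_one]) | (exfalso; omega)
    · refine tens_eq_neg_of_pointwise _ _ j' ?_ ?_
      · cases b' <;>
          (simp only [sigmaWord, Bool.false_eq_true, if_true, if_false]
           split_ifs <;> first | decide | (exfalso; omega))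
      · intro i hi
        have hi' : i.1 ≠ j'.1 := fun e => hi (Fin.ext e)
        simp only [sigmaWord, if_neg hi']
        split_ifs <;> first | rfl | (simp only [one_mul, mul_one]) | (exfalso; omega)

/-- The size of the `σ_i` is `4^m` (`= 4^{⌈ℓ/2⌉}` for `ℓ = 2m` or `2m − 1` matrices).
[cite: LeeWei2014, Lemma 14] -/
theorem card_sigmaIndex (m : ℕ) : Fintype.card (Fin m → Fin 4) = 4 ^ m := by
  rw [Fintype.card_fun, Fintype.card_fin, Fintype.card_fin]

/-- The `σ_i` as real matrices. [cite: LeeWei2014, Lemma 14] -/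
def sigmaR (m : ℕ) (jb : Fin m × Bool) : Matrix (Fin m → Fin 4) (Fin m → Fin 4) ℝ :=
  (sigma m jb).map (Int.castRingHom ℝ)

/-- `σ_i² = I` over `ℝ`. [cite: LeeWei2014, Lemma 14] -/
theorem sigmaR_mul_self {m : ℕ} (jb : Fin m × Bool) : sigmaR m jb * sigmaR m jb = 1 := by
  rw [sigmaR, ← Matrix.map_mul, sigma_mul_self, Matrix.map_one _ (map_zero _) (map_one _)]

/-- `σ_i σ_j = −σ_j σ_i` (`i ≠ j`) over `ℝ`. [cite: LeeWei2014, Lemma 14] -/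
theorem sigmaR_anticomm {m : ℕ} {jb jb' : Fin m × Bool} (h : jb ≠ jb') :
    sigmaR m jb * sigmaR m jb' = -(sigmaR m jb' * sigmaR m jb) := by
  rw [sigmaR, sigmaR, ← Matrix.map_mul, sigma_anticomm h, Matrix.map_neg _ (map_neg _), Matrix.map_mul]

/-- The `σ_i` "are matrices with rational [indeed integer] entries". [cite: LeeWei2014, Lemma 14] -/
theorem sigmaR_apply_eq_intCast {m : ℕ} (jb : Fin m × Bool) (s t : Fin m → Fin 4) :
    sigmaR m jb s t = ((sigma m jb s t : ℤ) : ℝ) := rfl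

/-- **Lee–Wei Lemma 14 (the identity).** For pairwise anticommuting involutions `σ_j` and any reals
`a_j`: "`(Σ_j a_j σ_j)(Σ_j a_j σ_j) = (Σ_j a_j²) I`". [cite: LeeWei2014, Lemma 14] -/
theorem clifford_sq {J T : Type} [Fintype J] [DecidableEq J] [Fintype T] [DecidableEq T]
    (σ : J → Matrix T T ℝ) (hanti : ∀ j j', j ≠ j' → σ j * σ j' = -(σ j' * σ j))
    (hsq : ∀ j, σ j * σ j = 1) (a : J → ℝ) :
    (∑ j, a j • σ j) * (∑ j, a j • σ j) = (∑ j, a j ^ 2) • (1 : Matrix T T ℝ) := by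
  set f : J → J → Matrix T T ℝ := fun j j' => (a j * a j') • (σ j * σ j') with hf
  have hexp : (∑ j, a j • σ j) * (∑ j, a j • σ j) = ∑ j, ∑ j', f j j' := by
    rw [Finset.sum_mul]
    refine Finset.sum_congr rfl fun j _ => ?_
    rw [Finset.mul_sum]
    refine Finset.sum_congr rfl fun j' _ => ?_
    rw [hf, Matrix.smul_mul, Matrix.mul_smul, smul_smul]
  have hanti' : ∀ j j', j ≠ j' → f j j' = -f j' j := by
    intro j j' hjj
    simp only [hf]
    rw [hanti j j' hjj, smul_neg, mul_comm (a j) (a j')]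
  -- the off-diagonal part vanishes
  set S := ∑ j, ∑ j' ∈ Finset.univ.erase j, f j j' with hS
  have hS0 : S = 0 := by
    have h1 : S = -S := by
      calc S = ∑ j', ∑ j ∈ Finset.univ.erase j', f j j' := by
            rw [hS]
            exact Finset.sum_comm' fun j j' => by
              simp only [Finset.mem_univ, Finset.mem_erase, ne_eq, and_true, true_and]
              exact ⟨fun h => Ne.symm h, fun h => Ne.symm h⟩
        _ = ∑ j', ∑ j ∈ Finset.univ.erase j', -f j' j := by
            refine Finset.sum_congr rfl fun j' _ => Finset.sum_congr rfl fun j hj => ?_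
            exact hanti' j j' (Finset.ne_of_mem_erase hj)
        _ = -S := by simp only [Finset.sum_neg_distrib, hS]
    have h2 : (2 : ℝ) • S = 0 := by rw [two_smul]; nth_rw 2 [h1]; exact add_neg_cancel S
    exact (smul_eq_zero.mp h2).resolve_left two_ne_zero
  rw [hexp]
  calc ∑ j, ∑ j', f j j' = ∑ j, (f j j + ∑ j' ∈ Finset.univ.erase j, f j j') := by
        refine Finset.sum_congr rfl fun j _ => ?_
        rw [Finset.add_sum_erase _ _ (Finset.mem_univ j)]
    _ = ∑ j, f j j + S := by rw [Finset.sum_add_distrib]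
    _ = ∑ j, (a j ^ 2) • (1 : Matrix T T ℝ) := by
        rw [hS0, add_zero]
        refine Finset.sum_congr rfl fun j _ => ?_
        simp only [hf]; rw [hsq j, pow_two]
    _ = (∑ j, a j ^ 2) • (1 : Matrix T T ℝ) := by rw [Finset.sum_smul]

/-- **Lee–Wei Lemma 14.** For every `m` there are `2m` integral (hence rational) matrices `σ_i` of size
`4^m` with `(Σ_j a_j σ_j)² = (Σ_j a_j²) I` for all reals `a_j` (pairwise anticommuting involutions).
[cite: LeeWei2014, Lemma 14] -/
theorem LeeWei2014_lemma14 (m : ℕ) (a : Fin m × Bool → ℝ) :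
    (∑ jb, a jb • sigmaR m jb) * (∑ jb, a jb • sigmaR m jb) =
      (∑ jb, a jb ^ 2) • (1 : Matrix (Fin m → Fin 4) (Fin m → Fin 4) ℝ) :=
  clifford_sq (sigmaR m) (fun _ _ h => sigmaR_anticomm h) sigmaR_mul_self a

/-! #### Theorem 13 -/

/-- Subadditivity of the rank. [folklore] -/
private theorem rank_add_le' {ι κ : Type} [Fintype ι] [Fintype κ] (A B : Matrix ι κ ℝ) :
    (A + B).rank ≤ A.rank + B.rank := by
  unfold Matrix.rank
  rw [Matrix.mulVecLin_add]
  calc Module.finrank ℝ (LinearMap.range (A.mulVecLin + B.mulVecLin))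
      ≤ Module.finrank ℝ ↥(LinearMap.range A.mulVecLin ⊔ LinearMap.range B.mulVecLin) := by
        apply Submodule.finrank_mono
        rintro _ ⟨v, rfl⟩
        exact Submodule.add_mem_sup ⟨v, rfl⟩ ⟨v, rfl⟩
    _ ≤ _ := Submodule.finrank_add_le_finrank_add_finrank _ _

/-- `rank (Σ_j A_j) ≤ Σ_j rank A_j`. [folklore] -/
private theorem rank_sum_le' {ι κ J : Type} [Fintype ι] [Fintype κ] [DecidableEq J] (s : Finset J)
    (A : J → Matrix ι κ ℝ) : (∑ j ∈ s, A j).rank ≤ ∑ j ∈ s, (A j).rank := by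
  induction s using Finset.induction_on with
  | empty => simp
  | insert j s hj ih =>
    rw [Finset.sum_insert hj, Finset.sum_insert hj]
    exact (rank_add_le' _ _).trans (Nat.add_le_add_left ih _)

/-- Rationals lie in every intermediate field of `ℝ/ℚ`. [folklore] -/
private theorem ratCast_mem' (F : IntermediateField ℚ ℝ) (q : ℚ) : (q : ℝ) ∈ F := by
  rw [← eq_ratCast (algebraMap ℚ ℝ) q]; exact F.algebraMap_mem q

/-- **Lee–Wei Theorem 13.** "Let `P_n` be as in Definition 11 and consider a decomposition of the form
`P_n = Σ_{j=1}^{d²} (B_j ∘ √P_n) ∘ (B_j ∘ √P_n)`, where each matrix `B_j` has rational entries. Let `k`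
[be] the maximum of `rank(B_j ∘ √P_n)` over `j ∈ [d²]`. Then `kd² ≥ ½ C(n, ⌈n/3⌉)`." Typed in the
sharper form the printed proof gives, for any finite index set of terms and any prime `p ≥ 3`:
`N ≤ 2 Σ_j rank(B_j ∘ √P_n)` (`N = C(n,p+1)` the size of `P_n`). Proof as printed: with the `σ_j` of
Lemma 14 put `A_j = (B_j ∘ √P_n) ⊗ σ_j`, `C = Σ_j A_j` (`rank C ≤ Σ_j rank(B_j ∘ √P_n)·4^m`, tree:
`rank_kronecker_le_rank_mul_rank`), and `D` block diagonal with blocks `(p−1)^{−1/2} Σ_j B_j(i,i) σ_j`;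
then the diagonal blocks of `DC` are `√p I` (Lemma 14 with `Σ_j B_j(i,i)² = 1`) and its off-diagonal
blocks have entries in `𝔽 = ℚ(√q : q < p)`, so Theorem 9 gives `rank C ≥ rank DC ≥ ½ N 4^m`.
[cite: LeeWei2014, Thm. 13] -/
theorem LeeWei2014_thm13 {p : ℕ} (hp : p.Prime) (h3 : 3 ≤ p) {J : Type} [Fintype J] [DecidableEq J]
    (B : J → Matrix (WeightSets n (p + 1)) (WeightSets n (p + 1)) ℝ)
    (hBrat : ∀ j x y, ∃ q : ℚ, (q : ℝ) = B j x y)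
    (hdec : ∀ x y, lwP n p x y = ∑ j, (B j x y * Real.sqrt (lwP n p x y)) ^ 2) :
    Fintype.card (WeightSets n (p + 1)) ≤
      2 * ∑ j, (Matrix.of fun x y => B j x y * Real.sqrt (lwP n p x y)).rank := by
  classical
  -- the Clifford matrices
  set m := Fintype.card J with hm
  let e : J ≃ Fin m := Fintype.equivFin J
  set T : Type := Fin m → Fin 4 with hT
  let τ : J → Matrix T T ℝ := fun j => sigmaR m (e j, false)
  have hτanti : ∀ j j', j ≠ j' → τ j * τ j' = -(τ j' * τ j) := fun j j' hjj =>
    sigmaR_anticomm fun h => hjj (e.injective (Prod.ext_iff.mp h).1)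
  have hτsq : ∀ j, τ j * τ j = 1 := fun j => sigmaR_mul_self _
  -- notation
  set F := primeSqrtField p with hF
  set a := Real.sqrt p with ha
  have hp3 : (3 : ℝ) ≤ p := by exact_mod_cast h3
  have ha0 : 0 < a := Real.sqrt_pos.2 (by linarith)
  have haF : a ∉ F := sqrt_prime_not_mem hp
  have ha2 : a ^ 2 ∈ F := by rw [ha, Real.sq_sqrt (by linarith)]; exact natCast_mem F p
  set c := Real.sqrt ((p : ℝ) - 1) with hc
  have hc0 : 0 < c := Real.sqrt_pos.2 (by linarith)
  have hcF : c ∈ F := by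
    have := sqrt_mem_of_lt (p := p) (t := p - 1) (by omega)
    rwa [Nat.cast_sub hp.one_lt.le, Nat.cast_one] at this
  set S : WeightSets n (p + 1) → WeightSets n (p + 1) → ℝ := fun x y => Real.sqrt (lwP n p x y) with hSdef
  have hS2 : ∀ x y, S x y ^ 2 = lwP n p x y := fun x y => Real.sq_sqrt (lwP_nonneg x y)
  have hSdiag : ∀ x, S x x = a * c := by
    intro x
    simp only [hSdef]
    rw [lwP_diag, ha, hc, ← Real.sqrt_mul (Nat.cast_nonneg p)]
  have hSF : ∀ x y, x ≠ y → S x y ∈ F := fun x y hxy => sqrt_entry_mem h3 (card_inter_le hxy)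
  set A : J → Matrix (WeightSets n (p + 1)) (WeightSets n (p + 1)) ℝ :=
    fun j => Matrix.of fun x y => B j x y * S x y with hA
  -- `Σ_j B_j(x,x)² = 1`
  have hb : ∀ x, ∑ j, B j x x ^ 2 = 1 := by
    intro x
    have h := hdec x x
    simp only [mul_pow] at h
    rw [← Finset.sum_mul, hS2] at h
    have hne : lwP n p x x ≠ 0 := by
      rw [lwP_diag]; exact mul_ne_zero (by positivity) (by linarith)
    -- `P = (Σ b²) P` with `P ≠ 0`
    have := mul_right_cancel₀ hne (h.symm.trans (one_mul _).symm)
    exact this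
  -- the matrices `C` and `D`
  set Cm : Matrix (WeightSets n (p + 1) × T) (WeightSets n (p + 1) × T) ℝ := ∑ j, A j ⊗ₖ τ j with hCm
  set Sv : (J → ℝ) → Matrix T T ℝ := fun v => ∑ j, v j • τ j with hSv
  have hSsq : ∀ v : J → ℝ, Sv v * Sv v = (∑ j, v j ^ 2) • (1 : Matrix T T ℝ) :=
    fun v => clifford_sq τ hτanti hτsq v
  set D : Matrix (WeightSets n (p + 1) × T) (WeightSets n (p + 1) × T) ℝ :=
    Matrix.of fun xs yt => if xs.1 = yt.1 then c⁻¹ * Sv (fun j => B j xs.1 xs.1) xs.2 yt.2 else 0 with hD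
  -- entries of `C` and of `DC`
  have hCapply : ∀ x y (u t : T), Cm (x, u) (y, t) = S x y * Sv (fun j => B j x y) u t := by
    intro x y u t
    simp only [hCm, hSv, Matrix.sum_apply, Matrix.kroneckerMap_apply, hA, Matrix.of_apply,
      Matrix.smul_apply, smul_eq_mul, Finset.mul_sum]
    refine Finset.sum_congr rfl fun j _ => ?_; ring
  have hDC : ∀ x y (s t : T), (D * Cm) (x, s) (y, t) =
      c⁻¹ * S x y * (Sv (fun j => B j x x) * Sv (fun j => B j x y)) s t := by
    intro x y s t
    rw [Matrix.mul_apply, Fintype.sum_prod_type]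
    simp only [hD, Matrix.of_apply]
    rw [Finset.sum_eq_single x (fun z _ hz => by simp [Ne.symm hz]) (fun h => (h (Finset.mem_univ x)).elim)]
    simp only [if_true, hCapply, Matrix.mul_apply, Finset.mul_sum]
    refine Finset.sum_congr rfl fun u _ => ?_; ring
  -- `DC = √p I + Am` with `Am` over `F`
  set Am := D * Cm - a • (1 : Matrix (WeightSets n (p + 1) × T) (WeightSets n (p + 1) × T) ℝ) with hAm
  have hE : D * Cm = a • (1 : Matrix _ _ ℝ) + Am := by rw [hAm]; abel
  have hSvF : ∀ (v w : J → ℝ), (∀ j, v j ∈ F) → (∀ j, w j ∈ F) → ∀ s t : T, (Sv v * Sv w) s t ∈ F := by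
    intro v w hv hw s t
    rw [Matrix.mul_apply]
    refine sum_mem fun u _ => mul_mem ?_ ?_
    · simp only [hSv, Matrix.sum_apply, Matrix.smul_apply, smul_eq_mul]
      exact sum_mem fun j _ => mul_mem (hv j) (intCast_mem F (sigma m (e j, false) s u))
    · simp only [hSv, Matrix.sum_apply, Matrix.smul_apply, smul_eq_mul]
      exact sum_mem fun j _ => mul_mem (hw j) (intCast_mem F (sigma m (e j, false) u t))
  have hBF : ∀ j x y, B j x y ∈ F := by
    intro j x y; obtain ⟨q, hq⟩ := hBrat j x y; rw [← hq]; exact ratCast_mem' F q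
  have hAF : ∀ xs yt, Am xs yt ∈ F := by
    rintro ⟨x, s⟩ ⟨y, t⟩
    rw [hAm, Matrix.sub_apply, Matrix.smul_apply, Matrix.one_apply, hDC]
    by_cases hxy : x = y
    · subst hxy
      rw [hSsq, hb, one_smul, Matrix.one_apply, hSdiag]
      have : c⁻¹ * (a * c) * (if s = t then (1 : ℝ) else 0) - a • (if (x, s) = (x, t) then (1 : ℝ) else 0) = 0 := by
        by_cases hst : s = t
        · subst hst; simp only [if_true, smul_eq_mul, mul_one]; field_simp; ring
        · have : (x, s) ≠ (x, t) := fun h => hst (Prod.ext_iff.mp h).2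
          rw [if_neg hst, if_neg this, mul_zero, smul_zero, sub_zero]
      rw [this]; exact zero_mem F
    · have hne : (x, s) ≠ (y, t) := fun h => hxy (Prod.ext_iff.mp h).1
      rw [if_neg hne, smul_zero, sub_zero]
      exact mul_mem (mul_mem (inv_mem hcF) (hSF x y hxy))
        (hSvF _ _ (fun j => hBF j x x) (fun j => hBF j x y) s t)
  -- Theorem 9 and the rank count
  have key := card_le_two_mul_rank F haF ha2 Am hAF
  rw [← hE] at key
  have hrankC : Cm.rank ≤ (∑ j, (A j).rank) * Fintype.card T := by
    rw [hCm, Finset.sum_mul]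
    refine (rank_sum_le' _ _).trans (Finset.sum_le_sum fun j _ => ?_)
    exact (Literature.LinearAlgebra.Matrix.HadamardProductRank.rank_kronecker_le_rank_mul_rank _ _).trans
      (Nat.mul_le_mul_left _ (Matrix.rank_le_card_width _))
  have hT : 0 < Fintype.card T := Fintype.card_pos
  have h1 : Fintype.card (WeightSets n (p + 1)) * Fintype.card T ≤
      (2 * ∑ j, (A j).rank) * Fintype.card T := by
    calc Fintype.card (WeightSets n (p + 1)) * Fintype.card T
        = Fintype.card (WeightSets n (p + 1) × T) := (Fintype.card_prod _ _).symm
      _ ≤ 2 * (D * Cm).rank := key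
      _ ≤ 2 * Cm.rank := Nat.mul_le_mul_left 2 (Matrix.rank_mul_le_right _ _)
      _ ≤ 2 * ((∑ j, (A j).rank) * Fintype.card T) := Nat.mul_le_mul_left 2 hrankC
      _ = (2 * ∑ j, (A j).rank) * Fintype.card T := by ring
  exact Nat.le_of_mul_le_mul_right h1 hT

/-- **Theorem 13, printed shape `kd² ≥ N/2`**: with `k` the maximum rank of the `B_j ∘ √P_n` and `d²`
(here `|J|`) terms. [cite: LeeWei2014, Thm. 13] -/
theorem LeeWei2014_thm13_max {p : ℕ} (hp : p.Prime) (h3 : 3 ≤ p) {J : Type} [Fintype J] [DecidableEq J]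
    (B : J → Matrix (WeightSets n (p + 1)) (WeightSets n (p + 1)) ℝ)
    (hBrat : ∀ j x y, ∃ q : ℚ, (q : ℝ) = B j x y)
    (hdec : ∀ x y, lwP n p x y = ∑ j, (B j x y * Real.sqrt (lwP n p x y)) ^ 2) {k : ℕ}
    (hk : ∀ j, (Matrix.of fun x y => B j x y * Real.sqrt (lwP n p x y)).rank ≤ k) :
    Fintype.card (WeightSets n (p + 1)) ≤ 2 * (Fintype.card J * k) := by
  refine (LeeWei2014_thm13 hp h3 B hBrat hdec).trans (Nat.mul_le_mul_left 2 ?_)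
  calc ∑ j, (Matrix.of fun x y => B j x y * Real.sqrt (lwP n p x y)).rank ≤ ∑ _j : J, k :=
        Finset.sum_le_sum fun j _ => hk j
    _ = Fintype.card J * k := by rw [Finset.sum_const, smul_eq_mul, Finset.card_univ]

/-- **Theorem 13 with the printed count `kd² ≥ ½ C(n, ⌈n/3⌉)`** (Def. 11: "the size of `P_n` is at
least `C(n, ⌈n/3⌉)`"): for `n ≥ 6` and the Bertrand prime `p` of `LeeWei2014_thm12_exp`,
`C(n, ⌈n/3⌉) ≤ C(n, p+1) ≤ 2 k |J|`. [cite: LeeWei2014, Thm. 13, Def. 11] -/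
theorem LeeWei2014_thm13_printed {n : ℕ} (hn : 6 ≤ n) :
    ∃ p : ℕ, p.Prime ∧ 3 ≤ p ∧ p + 1 ≤ n ∧
      ∀ (J : Type) [Fintype J] [DecidableEq J]
        (B : J → Matrix (WeightSets n (p + 1)) (WeightSets n (p + 1)) ℝ),
        (∀ j x y, ∃ q : ℚ, (q : ℝ) = B j x y) →
        (∀ x y, lwP n p x y = ∑ j, (B j x y * Real.sqrt (lwP n p x y)) ^ 2) →
        ∀ k : ℕ, (∀ j, (Matrix.of fun x y => B j x y * Real.sqrt (lwP n p x y)).rank ≤ k) →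
          n.choose ((n + 2) / 3) ≤ 2 * (Fintype.card J * k) := by
  obtain ⟨p, hp, hqp, hp2q⟩ := Nat.exists_prime_lt_and_le_two_mul (n / 3) (by omega)
  have hp3 : 3 ≤ p := by omega
  have hpodd : p ≠ 2 * (n / 3) := by
    intro h
    rcases hp.eq_one_or_self_of_dvd 2 ⟨n / 3, h⟩ with h2 | h2 <;> omega
  refine ⟨p, hp, hp3, by omega, fun J _ _ B hBrat hdec k hk => ?_⟩
  have hN := LeeWei2014_thm13_max hp hp3 B hBrat hdec hk
  rw [card_weightSets] at hN
  exact (choose_le_choose_middle (by omega) (by omega)).trans hN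


/-! ### Two remarks used downstream: the rescaling engine in general form, and `rank_√(B_n) ≤ n + 1` -/

/-- **The rescaling step of Theorems 12/13 in general form.** If every diagonal entry of a real square
matrix `B` is `a·w_x` with `w_x ∈ K`, `w_x ≠ 0`, every off-diagonal entry lies in `K`, and `a ∉ K`,
`a² ∈ K` (e.g. `a = √p`), then `N ≤ 2·rank B`: multiply row `x` by `w_x⁻¹ ∈ K` ("multiplying `B` on the
left by a diagonal matrix `D` … we can obtain a matrix `C = DB` … whose diagonal entries are all `√p`
… `C = √p I + A` for a matrix `A` with all entries in `𝔽`") and apply Theorem 9 (`rank DB ≤ rank B`).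
[cite: LeeWei2014, Thm. 12 (proof)] -/
theorem card_le_two_mul_rank_of_rescaling {ι : Type} [Fintype ι] [DecidableEq ι]
    (K : IntermediateField ℚ ℝ) {a : ℝ} (ha : a ∉ K) (ha2 : a ^ 2 ∈ K) (B : Matrix ι ι ℝ)
    (hdiag : ∀ x, ∃ w : ℝ, w ∈ K ∧ w ≠ 0 ∧ B x x = a * w) (hoff : ∀ x y, x ≠ y → B x y ∈ K) :
    Fintype.card ι ≤ 2 * B.rank := by
  classical
  choose w hwK hw0 hBw using hdiag
  set D : Matrix ι ι ℝ := Matrix.diagonal fun x => (w x)⁻¹ with hD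
  set Am : Matrix ι ι ℝ := D * B - a • (1 : Matrix ι ι ℝ) with hAm
  have hE : D * B = a • (1 : Matrix ι ι ℝ) + Am := by rw [hAm]; abel
  have hAK : ∀ x y, Am x y ∈ K := by
    intro x y
    rw [hAm, Matrix.sub_apply, Matrix.smul_apply, Matrix.one_apply, hD, Matrix.diagonal_mul]
    by_cases hxy : x = y
    · subst hxy
      rw [if_pos rfl, smul_eq_mul, mul_one, hBw x, ← mul_assoc, mul_comm (w x)⁻¹ a, mul_assoc,
        inv_mul_cancel₀ (hw0 x), mul_one, sub_self]
      exact zero_mem K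
    · rw [if_neg hxy, smul_zero, sub_zero]
      exact mul_mem (inv_mem (hwK x)) (hoff x y hxy)
  have key := card_le_two_mul_rank K ha ha2 Am hAK
  rw [← hE] at key
  exact key.trans (Nat.mul_le_mul_left 2 (Matrix.rank_mul_le_right _ _))

/-- **§3.1: the unique-disjointness matrix is useless for psd rank** — "this matrix is not a suitable
candidate as `A_n = [xᵀy − 1]_{x,y ∈ {0,1}ⁿ}` satisfies `A_n ∘ A_n = B_n` and has rank at most `n + 1`",
i.e. `rank_√(B_n) ≤ n + 1` for `B_n(x,y) = (xᵀy − 1)²` (the tree's `klwMatrix`, written here on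
`bvec`). [cite: LeeWei2014, §3.1] -/
theorem hasHadamardSqrtOfRankLE_udisj (n : ℕ) :
    HasHadamardSqrtOfRankLE (Matrix.of fun x y : Cube n => (bvec x ⬝ᵥ bvec y - 1) ^ 2) (n + 1) := by
  classical
  set P : Matrix (Cube n) (Fin (n + 1)) ℝ :=
    Matrix.of fun x i => Fin.lastCases (1 : ℝ) (fun i : Fin n => bvec x i) i with hP
  set Q : Matrix (Fin (n + 1)) (Cube n) ℝ :=
    Matrix.of fun i y => Fin.lastCases (-1 : ℝ) (fun i : Fin n => bvec y i) i with hQ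
  have hPQ : P * Q = Matrix.of fun x y : Cube n => bvec x ⬝ᵥ bvec y - 1 := by
    ext x y
    rw [Matrix.mul_apply, Fin.sum_univ_castSucc]
    simp only [hP, hQ, Matrix.of_apply, Fin.lastCases_castSucc, Fin.lastCases_last, dotProduct]
    ring
  refine ⟨Matrix.of fun x y : Cube n => bvec x ⬝ᵥ bvec y - 1, fun x y => rfl, ?_⟩
  rw [← hPQ]
  exact (Matrix.rank_mul_le_left _ _).trans ((Matrix.rank_le_card_width P).trans (by simp))


end SquareRootRank

end Literature.Combinatorics.Optimization
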